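import Literature.MathematicalPhysics.QuantumFieldTheory.Balaban1983to89.B9Eq375Locality
import Literature.MathematicalPhysics.QuantumFieldTheory.Balaban1983to89.B9Eq386Neumann

/-!
# `Balaban1983to89.B9Eq373V3` — B9, p. 404: «for the difference Δ′(U′U) − Δ′(U) we have a bound similar to (3.69), but with additional
# factor α₁» and p. 407: «The operator V₃(A) is a local differential operator of the first order satisfying the bound (3.73)» — the
# two-configuration difference bound for the operator `Δ′` of (3.10) DERIVED from (3.10), its specialisation to `U′U = e^{iηA}U` under
# (3.35)/(3.37)-type letters with the factor `α₁` explicit, and the bond-field value, the (3.73)-shaped bound and the locality clause of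
# `V₃(A) = V₁(A) − (Δ′(U′U) − Δ′(U)) + V₂(A)` of (3.82); v1

CITATION HEADER (lean-in-tree rule).  Audit cell `pub-balaban`, surge node-prover lineage pv27 (B9 pp. 390–392, 396–397, 404–407),
unit `b2b-balaban-pv27-g20` (journal CLAIM l.277 of the rotated `CLAIMS.log`, node B9-EQ373-V3; YIELD CLAUSE — own-lineage kernel node,
self-assigned; first kernel node of the seat, after the docstring-only re-lands `B9Eq375Locality` v1.2 = p193233, `B9Eq380Telescope` v1.1
= p193234).  Source: T. Bałaban, *Propagators for lattice gauge theories in a background field*, Commun. Math. Phys. **99** (1985) 389–434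
[Balaban1985BackgroundPropagators] (cell paper B9; journal page = PDF page + 388), p. 404 [PDF 16] ((3.69) and the sentences after it),
p. 405 [PDF 17] ((3.73) and its constant sentence) and p. 407 [PDF 19] ((3.82) and the sentence after it), quoted from the page renders
`b2b-balaban-ref1/pages/1985-cmp99-background-propagators/…-p016-x4.png`, `…-p017-x4.png`, `…-p019-x4.png` READ AS IMAGES by this
seat (2026-08-19).  Imports BY NAME: `B9Eq375Locality` (and through it `B9Eq375Composition`, `B9Eq372Locality`, `B9Eq371Composition`,
`B9Eq370Expansion`, `B9Eq369Product`, `B9Eq369Small`, `B9Eq310Hermitian`, `B9Eq39Adjoint`, `B9Eq37Insertion`, `B12Membership314`,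
`B12Plaquette343`, `Beta.TransportVertices`) and the abstract assembly leaf `B9Eq386Neumann` (`vThree`).  (The CLAIM line also named
`B9Eq372Operator`; it is not needed — `V₃(A)A′` is typed as a bond-field VALUE, like `V₁op`, `V₂op`; see NOT PROVED.)

HONEST FRAMING (cell charter, verbatim in substance).  The cell audits Bałaban's papers; discharging its end statements would
make Bałaban's ultraviolet stability theorem unconditional inside this package — a constructive-QFT statement; it is NOT the
continuum limit and NOT the Clay problem.  THIS FILE DISCHARGES NOTHING of the series: it is a finite estimate — a Lipschitz bound
for the plaquette operator `Δ′` of (3.10) in its configuration argument, a second-order expansion of one plaquette word, real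
arithmetic at the printed letters, three triangle inequalities and a dependence-set bookkeeping — on the lineage's lattice carrier
(`B9Eq39Adjoint`: `R W X = WXW⁻¹`, `covD`, `curl`, `plaqU`, `prodCfg U η A = (b ↦ e^{iηA(b)}·U(b))`), consuming BY NAME `B9Eq310Hermitian`
(`zP`, `yP`, `jordanF`, `sgnSum_k`, `commG_k`, `divL`, `divL_self`, `deltaPrimeOp` = the operator `Δ′` of (3.10)), `B9Eq369Small` (`Through`
= «p ∈ st(b)», `norm_R_le_rho`, `norm_R_inv_le_rho`, `le_rho_sq_mul`, `norm_plaqU_le`, `norm_plaqU_inv_le`, `norm_eta_inv_sq`,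
`norm_zP_le_of_plaq`, `norm_yP_le_of_plaq`, `xi_sq_div_eta_sq`, `deltaPrimeOp_congr_local`, `divL_congr_local`), `B9Eq369Product`
(`prodCfg_zero`, `plaqU_prodCfg_val`, `far_sub_near_eq_curl`, `norm_R_far_le`, `letterSize`, `norm_prodCfg_le`, `one_le_exp_mul`),
`B9Eq370Expansion` (`R_fluct`, `R_inv_prodCfg`, `norm_conj_sub_le`), `B12Membership314` (`dressed_sub_holonomy`, `norm_mul_exp_le`,
`norm_I_mul_smul`), `B12Plaquette343` (`elem343`: the second-order remainder of a four-letter exponential word), `Beta.TransportVertices`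
(`norm_exp_sub_one_le_expTail`, `norm_exp_mul_le`), `B9Eq37Insertion` (`reC`, `imC`), `B9Eq371Composition` (`V₁op`, `norm_V₁op_le_printed` =
(3.73) for `V₁`), `B9Eq375Composition` (`V₂op`, `norm_V₂op_le_printed` = (3.73) for `V₂`), `B9Eq372Locality` (`stBonds`, `pBonds`,
`mem_stBonds_iff`, `V₁op_congr_st`), `B9Eq375Locality` (`locBonds₂`, `V₂op_congr_loc`) and `B9Eq386Neumann` (`vThree V₁ V₂ Δp Δp′ = V₁ −
(Δp′ − Δp) + V₂`, the sign pattern of the third equality of (3.82)).  Value = kernel certificate of the two «it is easy to see»/«satisfying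
the bound» sentences that close the `Δ′`- and `V₃`-parts of (3.82) before the Neumann series (3.84)–(3.86): the un-displayed bound for
`Δ′(U′U) − Δ′(U)` with every constant explicit (§2–§3), and (3.73) for `V₃` as the SUM of the lineage's (3.73) for `V₁`, for `V₂` and of §3,
with the locality clause typed as a congruence theorem (§4).  NOT summit progress.

ABSOLUTE RULE.  No internally-minted statement enters as a cited fact.  Every declaration below is PROVED (tags `[folklore]`);
the `[cite: …]` tags document WHICH PRINTED CLAUSE a definition or a proved statement transcribes — the proofs are ours, the
print is not used as a hypothesis anywhere.  The inputs (3.35) (`‖U(∂p) − 1‖ ≤ C₀L^{−2j}` on the plaquettes through `b`) and (3.37)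
(`‖A(b′)‖ ≤ a ≤ α₁(L^jη)⁻¹`, `‖(D¹_U A)‖ ≤ g ≤ η·α₁(L^jη)⁻²`, and `‖A′‖ ≤ a′`, `‖D¹_U A′‖ ≤ g′` for the argument) enter the `_printed` /
`eq…` theorems as HYPOTHESES on the letters, with `α₁`, `C₀`, `L ≥ 1`, `η > 0`, `j` as binders.

LETTERS AND NORMALISATION (as `B9Eq370Expansion`/`B9Eq371Composition`): `A` = exponent field of `U′ = e^{iηA}`, `U′U = prodCfg U η A`;
`A′` = the argument; `D¹ = covD = ηD` (so `g′` bounds `η|∇^η_U A′|` and the print's `|∇A′|` is `η⁻¹g′`); `(D¹_U A)(p) = curl` = `η` × the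
printed plaquette derivative.  SCALES: the lineage's `V₁op`, `V₂op` are `η²` × the print's `(V₁(A)A′)_μ(x)`, `(V₂(A)A′)_μ(x)`, whereas
`deltaPrimeOp` (weights `z(p) = η⁻²(Re U(∂p) − 1)`, `y(p) = η⁻² Im U(∂p)`) is `(Δ′(U)A′)(b)` at the PRINTED scale (`B9Eq369Small.eq369`
is (3.69) as printed); accordingly `V₃val := vThree (η⁻²·V₁op) (η⁻²·V₂op) (Δ′(U)A′) (Δ′(U′U)A′)` is `(V₃(A)A′)(b)` at the printed scale and
§3–§4 conclude with the print's `(L^jη)⁻²|A′|` and `(L^jη)⁻¹|∇A′|`.  A BOND is `(κ, z)` = `⟨z, z + e_κ⟩`; `x + e_ν = T ν x`; the positively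
oriented plaquettes through `b = ⟨x, x + e_μ⟩` are `B9Eq369Small.Through T μ x κ ν y` (`κ < ν`, `p = p_{κν}(y)` with `b ⊂ ∂p`).

WHAT IS IN PRINT («…» verbatim from the renders).  p. 404 [PDF 16]: «From the formula (3.10) it follows that Δ′(U′U) is a small
perturbation itself in the sense that we have the bound |(Δ′(U′U)A′)(b)| ≤ O(1)(Mα₀ + α₁)(L^jη)⁻²|A′|, b ∈ Ω_j (3.69) the supremum on
the right-hand side is taken over bonds belonging to one of the plaquettes containing the bond b (i.e. we have max_{b′:b′⊂∂p,p∈st(b)}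
|A′(b′)|, where st(b) = {plaquettes p : b ⊂ ∂p and orientation of ∂p agrees with that of b}). This bound follows from the estimates
|Re(U′U)(∂p) − 1|, |Im(U′U)(∂p)| ≤ O(1)(Mα₀ + α₁)ξ², ξ = L^{−j}. Let us recall that the operations Re and Im in this case were defined
after formula (3.7), and the estimates follow directly from the assumptions (3.35), (3.37). It is easy to see that for the difference
Δ′(U′U) − Δ′(U) we have a bound similar to (3.69), but with additional factor α₁. It is not essential in the sequal. Thus we have to
investigate only an expansion of the operator D*_{U′U}D_{U′U}.» [sic: «sequal»].  p. 405 [PDF 17], after (3.71) (fully transcribed in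
`B9Eq371Composition`/`B9Eq372Locality`): «The operator V₁ satisfies |(V₁(A)A′)(b)| ≤ O(1)(|A||∇A′| + |∇A||A′| + |A|²|A′|) ≤
O(1)α₁((L^jη)⁻¹|∇A′| + (L^jη)⁻²|A′|), b ∈ Ω_j, (3.73) with the same conditions on norms as above. The derivatives are, of course, the
covariant derivatives defined by U. The constant O(1) is an absolute constant depending on d only.»  p. 407 [PDF 19]: «Combining the
expansions (3.71), (3.76) and (3.80) we get Δ_a(U′U) = D*_{U′U}D_{U′U} + Δ′(U′U) + D_{U′U}R(U′U)D*_{U′U} + Q*(U′U)aQ(U′U) = Δ_a(U) − V₁(A) +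
(Δ′(U′U) − Δ′(U)) − V₂(A) − P₁(A) + F₂*(A)aQ(U) + Q*(U)aF₂(A) + F₂*(A)aF₂(A) = Δ_a(U) − V₃(A) − P₁(A) − P₂(A). (3.82) The operator V₃(A) is
a local differential operator of the first order satisfying the bound (3.73). The operator P₁(A) was defined in (3.76). […] The operators
V₃(A), P₁(A), P₂(A) depend analytically on A in the domain (3.37).»  (3.37), p. 396 [PDF 8]: «|A′| < α₁(L^jη)⁻¹, |∇^η_U A′| < α₁(L^jη)⁻² on
Ω_j, j = 0, …, k;».  READINGS.  (a) By the second and third members of (3.82), `V₃(A) = V₁(A) − (Δ′(U′U) − Δ′(U)) + V₂(A)` (the lineage's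
`B9Eq386Neumann.vThree`, whose `eq382_line2_eq_line3`/`eq382` certify the regrouping); «satisfying the bound (3.73)» = the second inequality of (3.73)
with `V₃` for `V₁` and the print's `O(1)` «depending on d only»; «local» = the value at `b` depends on `A`, `A′` near `b` only (typed in §4
with the dependence sets of the lineage: `st(b)` for `V₁` and `Δ′`, `locBonds₂(b)` for `V₂` — cf. DIVERGENCE D-pv27.12 of
`B9Eq375Locality`).  (b) «a bound similar to (3.69), but with additional factor α₁» for the DIFFERENCE: the kernel derivation from (3.10)
(§2–§3) gives `‖((Δ′(U′U) − Δ′(U))A′)(b)‖ ≤ (d − 1)·α₁·k_Δ(α₁, C₀)·(L^jη)⁻²·|A′|` with `k_Δ(0, 0) = 28 ≠ 0`: the factor `α₁` appears IN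
PLACE OF (3.69)'s `(Mα₀ + α₁)` — the weight differences `y_{U′U}(p) − y_U(p)`, `z_{U′U}(p) − z_U(p)` are first order in `η·(D¹_U A)(p)`,
which (3.37) bounds by `2α₁ξ²` flat — and `C₀` (the print's `O(1)(Mα₀ + α₁)` of (3.35) for the background) re-enters only multiplied by
`α₁`.  The literal multiplicative reading `O(1)(Mα₀ + α₁)·α₁·(L^jη)⁻²|A′|` is NOT what this route yields and is not claimed; since «It is
not essential in the sequal», the point is immaterial (DIVERGENCE D-pv27.14, LOW).

WHAT THIS FILE PROVES.  MODEL (as in the lineage leaves): `𝔸` a normed ℂ-algebra (complete where exponentials occur); sites `S`,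
directions `ι` (`Fintype`, `LinearOrder` where `Σ_ν`/`st(b)` occur), shifts `T ν : S ≃ S` (NO commutation assumed), background `U : ι → S
→ 𝔸ˣ` (ARBITRARY units; `‖U(b′)^{±1}‖ ≤ ρ` or `≤ 1` as a hypothesis where stated), fields `A, A′ : ι → S → 𝔸`; norms = the `NormedRing` norm;
`d − 1` = `Fintype.card ι − 1` (truncated subtraction, cast to `ℝ`).
* §1 ELEMENTARY DIFFERENCES: `exp_sub_one_le_mul_exp_of_le` (`e^t − 1 ≤ te^T`, `0 ≤ t ≤ T`); **`norm_exp_mul_mul_exp_neg_sub_le`** (`‖e^{a}Xe^{−c} − X‖ ≤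
  (e^{‖a‖+‖c‖} − 1)‖X‖`), `norm_dressed_sub_self_le` (four exponentials); for two units `P′, P` with `‖P′⁻¹‖ ≤ r′`, `‖P⁻¹‖ ≤ r`:
  `norm_units_inv_sub_inv_le` (`‖P′⁻¹ − P⁻¹‖ ≤ r′r‖P′ − P‖`), **`norm_reC_sub_reC_le`**, **`norm_imC_sub_imC_le`** (`≤ ½(1 + r′r)‖P′ − P‖`
  — `Re`, `Im` of p. 391 are `½(P ± P⁻¹)`-type), hence for two configurations `U`, `V` the plaquette WEIGHTS of (3.10):
  **`norm_zP_sub_zP_le`**, **`norm_yP_sub_yP_le`** (`‖z_V(p) − z_U(p)‖, ‖y_V(p) − y_U(p)‖ ≤ η⁻²·½(1 + r′r)·‖V(∂p) − U(∂p)‖`).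
* §2 (3.10) FOR TWO CONFIGURATIONS `U`, `V` (transports of size `ρ ≥ 1`, transport perturbation `σ`: `‖(R(V(b′)) − R(U(b′)))X‖ ≤ σ‖X‖`
  and the same for `R(·)⁻¹`; letters `‖A(b′)‖ ≤ a` on the plaquettes through `b`; weights `≤ δ`, weight differences `≤ θ`):
  `curl_sub_curl`, `norm_curl_sub_le_loc` (`≤ 2σa`), `norm_sgnSum_sub_le_loc`, the algebra `jordan_sub`, `comm_sub`,
  **`norm_jordanF_sub_le_loc`** (`‖F^J_V(p) − F^J_U(p)‖ ≤ 2σaδ + 4ρ²aθ`), **`norm_commG_sub_le_loc`** (`‖G_{k,V}(p) − G_{k,U}(p)‖ ≤ 3ρ²aθ +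
  2σaδ`, four slots), **`norm_divL_sub_le_loc`** (`‖÷_V H − ÷_U G‖ ≤ (2ρ²γ + σg)(d − 1)` from slot bounds `g` and slot differences `γ`),
  and the sum **`norm_deltaPrimeOp_sub_le_local`**: `‖(Δ′(V)A)(b) − (Δ′(U)A)(b)‖ ≤ (14ρ⁴θ + 15ρ²σδ)(d − 1)·a` (companion of the
  one-configuration `B9Eq369Small.norm_deltaPrimeOp_le_local` = `14ρ⁴(d − 1)aδ`).
* §3 `V = U′U`: **`norm_R_prodCfg_sub_le`** (`σ = ρ²(e^{2s} − 1)` for `η‖A‖ ≤ s`: «R(U′) = exp ηiad_A» minus `1`); the plaquette word: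
  **`norm_dressed_sub_le`** (pure algebra: `‖e^{iξH₁}e^{iξH₂}Pe^{−iξH₃}e^{−iξH₄} − P‖ ≤ ξ‖(H₂ − H₄) − (H₃ − H₁)‖ + ½S²ξ²e^{ξS} + (e^{ξS} −
  1)‖P − 1‖`), hence **`norm_plaqU_prodCfg_sub_plaqU_le`**: `‖(U′U)(∂p) − U(∂p)‖ ≤ η‖(D¹_U A)(p)‖ + ½S(p)²η²e^{ηS(p)} + (e^{ηS(p)} − 1)‖U(∂p)
  − 1‖` (`S(p)` = `letterSize`, the transported letters; the linear term IS `η` × the curl: `far_sub_near_eq_curl`), `…_of_bounds`, and at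
  the printed letters (`budget_diff`, `eta_mul_le_xi`, `eta_mul_le_xi_sq`, `alpha_nonneg_of_le`; constant **`kP`** `k_P(α₁, C₀) = 2 + (18α₁
  + 6C₀)e^{6α₁}`): **`norm_plaqU_prodCfg_sub_plaqU_le_printed`** `‖(U′U)(∂p) − U(∂p)‖ ≤ α₁·k_P·L^{−2j}` — one factor `α₁` MORE than the
  lineage's `‖(U′U)(∂p) − 1‖ ≤ e^{6α₁}(C₀ + 2α₁ + 18α₁²)L^{−2j}` (`B9Eq369Product.norm_plaqU_prodCfg_sub_one_le_printed`); constant **`kΔ`**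
  `k_Δ(α₁, C₀) = E⁴(14Θ + 30(C₀ + α₁Θ))`, `E = e^{α₁}`, `Θ = ½(1 + E⁴)k_P`; `through_or_card_le` (a plaquette through `b` exists or `d − 1 =
  0`); and the node's first target **`eq369_diff`** — p. 404: for a group-valued background (`‖U(b′)^{±1}‖ ≤ 1`), `‖A‖ ≤ a ≤ α₁(L^jη)⁻¹` and
  `‖D¹_U A‖ ≤ g ≤ ηα₁(L^jη)⁻²` on all bonds, `‖U(∂p) − 1‖ ≤ C₀L^{−2j}` and `‖A′(b′)‖ ≤ a′` on the plaquettes through `b`: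
  `‖(Δ′(U′U)A′)(b) − (Δ′(U)A′)(b)‖ ≤ (d − 1)·α₁·k_Δ(α₁, C₀)·(L^jη)⁻²·a′`.
* §4 `V₃` (p. 407): configuration-locality of `Δ′` — **`plaqU_congr_cfg`**, `jordanF_commG_congr_cfg`, `divL_congr_cfg`,
  **`deltaPrimeOp_congr_cfg`** (two configurations agreeing on `∂p` for every `p` through `b` give the same `(Δ′A)(b)`), `prodCfg_congr_pt`,
  `agree_through_of_stBonds` (converse bookkeeping of `B9Eq372Locality.agree_on_stBonds_of_through`); the value **`V₃val`** `:= vThree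
  (η⁻²V₁op) (η⁻²V₂op) (Δ′(U)A′(b)) (Δ′(U′U)A′(b))`, `V₃val_eq`, `norm_V₃val_le`; the node's second target **`eq373_V₃`** — (3.73) for `V₃`:
  under the hypotheses of `norm_V₁op_le_printed` (group-valued `U`, (3.37)-type `A`, argument letters `a′`, `g′`) and (3.35) on the
  plaquettes through `b`, `‖(V₃(A)A′)(b)‖ ≤ α₁·[20d·(L^jη)⁻¹·(η⁻¹g′) + (d·(10 + 12α₁e^{2α₁}(3 + 2α₁ + α₁²e^{2α₁})) + (d − 1)·k_Δ(α₁,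
  C₀))·(L^jη)⁻²·a′]` (`12 + 8 = 20`, `4 + 6 = 10`, `8 + 4 = 12` from the two lineage bounds; every `O(1)` explicit, absolute once `α₁ ≤ 1`, `C₀`
  fixed); and the locality clause **`V₃val_congr`**: `(V₃(A)A′)(b)` is unchanged when `A` and `A′` are modified off `stBonds(b) ∪ locBonds₂(b)`.
* §5 SANITY (`example`s): at `A = 0` the difference `Δ′(U′U) − Δ′(U)` vanishes and `V₃val` is `η⁻²(V₁op + V₂op)`; the §2 bound is `0` at
  `σ = θ = 0`; `k_P(0, 0) = 2`, `k_Δ(0, 0) = 28`.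

RELATED IN THE TREE, NOT DUPLICATED (searched 2026-08-19: MODULE-MAP rows B9/B12/Beta; `grep -rn "Δ′(U′U) − Δ′(U)\|V₃\|vThree\|(3.73)"
Balaban1983to89/`): `B9Eq369Small` (3.69) for `Δ′(U)` and `B9Eq369Product` (3.69) for `Δ′(U′U)` bound each operator SEPARATELY by
`O(1)(C₀ + α₁…)(L^jη)⁻²|A′|` — the difference with its factor `α₁` is not there (subtracting the two loses it); `B9Eq371Composition` /
`B9Eq375Composition` are (3.73) for `V₁` / `V₂`; `B9Eq386Neumann` is the ABSTRACT regrouping (3.82) ⟹ (3.84) ⟹ (3.86) over a ring, with the bound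
(3.73) for `V₃` a BINDER where used (its NOT PROVED list names it) — this file produces that bound on the lattice carrier at each bond; `B9Eq372Operator`
packages `V₁`, `F_{1,k}` as operators on the field space (not used: see NOT PROVED).  Nothing in the tree bounds `Δ′(U′U) − Δ′(U)` or types `V₃`.  The
real inequality `e^t − 1 ≤ te^t` is already `AreaLaw.exp_sub_one_le_mul_exp` (`Sweep1AreaLawProofs`, gate dedup 2026-08-19): not restated,
and not imported (that module's closure is the strong-coupling sweep + `HarnessLib`); §1 states only the weighted variant it needs.

NOT PROVED HERE, NOT CLAIMED: the domain geometry `b ∈ Ω_j` and the scale map `j(b)` (binders); `V₃(A)` as an OPERATOR on the weighted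
sup-normed field space of (3.85)/(3.86) and the operator-norm form of (3.73) (typed pointwise at each bond, as `V₁op`/`V₂op`; the packaging
is `B9Eq372Operator`'s pattern, left to a successor); «differential operator of the first order» beyond the shape of the bound (one
covariant derivative of `A′`); analyticity in `A` «in the domain (3.37)»; the literal multiplicative reading of «additional factor α₁»
(READINGS (b)); (3.76)/(3.77) (`P₁`), (3.83) (`P₂`) and everything after (3.82) (lineage `B9Eq386Neumann`, abstractly); any statement in the
normalised Hilbert–Schmidt norm of p. 392 (cell DIVERGENCE D-1).  Records: GAPS C-pv27-80, DIVERGENCE D-pv27.14 ((a) the mixed scale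
convention `η⁻²V₁op`, `η⁻²V₂op` vs printed-scale `Δ′`, harmless and explicit in `V₃val`; (b) the reading of «additional factor α₁» above;
modelling divergences as in D-pv27.10).  NOT summit progress.
-/

noncomputable section

open NormedSpace Complex

namespace Literature.MathematicalPhysics.QuantumFieldTheory.Balaban1983to89.B9Eq373V3

open Literature.MathematicalPhysics.QuantumFieldTheory.Balaban1983to89.Beta.TransportVertices
open Literature.MathematicalPhysics.QuantumFieldTheory.Balaban1983to89.B9Eq37Insertion
open Literature.MathematicalPhysics.QuantumFieldTheory.Balaban1983to89.B9Eq39Adjoint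
open Literature.MathematicalPhysics.QuantumFieldTheory.Balaban1983to89.B9Eq310Hermitian
open Literature.MathematicalPhysics.QuantumFieldTheory.Balaban1983to89.B9Eq369Small
open Literature.MathematicalPhysics.QuantumFieldTheory.Balaban1983to89.B9Eq369Product
open Literature.MathematicalPhysics.QuantumFieldTheory.Balaban1983to89.B9Eq370Expansion
open Literature.MathematicalPhysics.QuantumFieldTheory.Balaban1983to89.B9Eq371Composition
open Literature.MathematicalPhysics.QuantumFieldTheory.Balaban1983to89.B9Eq375Composition
open Literature.MathematicalPhysics.QuantumFieldTheory.Balaban1983to89.B9Eq372Locality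
open Literature.MathematicalPhysics.QuantumFieldTheory.Balaban1983to89.B9Eq375Locality
open Literature.MathematicalPhysics.QuantumFieldTheory.Balaban1983to89.B9Eq386Neumann

/-! ## §1  Elementary differences: a real inequality, dressed differences, `Re`/`Im` of two plaquette variables -/

section Real

/-- `e^t − 1 ≤ t·e^T` for `0 ≤ t ≤ T` (from `1 − t ≤ e^{−t}`; the case `T = t`, `e^t − 1 ≤ te^t` for all real `t`, is the tree's
`AreaLaw.exp_sub_one_le_mul_exp` of `Sweep1AreaLawProofs` — deliberately NOT imported, to keep the lineage's import closure free of the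
strong-coupling sweep; only this weighted variant is stated here). [folklore] -/
theorem exp_sub_one_le_mul_exp_of_le {t T : ℝ} (ht : 0 ≤ t) (hT : t ≤ T) : Real.exp t - 1 ≤ t * Real.exp T := by
  have h := Real.add_one_le_exp (-t)
  have hpos := Real.exp_pos t
  have e : Real.exp t * Real.exp (-t) = 1 := by rw [← Real.exp_add, add_neg_cancel, Real.exp_zero]
  have hT' := mul_le_mul_of_nonneg_left (Real.exp_le_exp.mpr hT) ht
  nlinarith [mul_le_mul_of_nonneg_left h hpos.le]

end Real

section Dressed

variable {𝔸 : Type*} [NormedRing 𝔸] [NormedAlgebra ℂ 𝔸] [CompleteSpace 𝔸]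

/-- `‖e^{a}·X·e^{−c} − X‖ ≤ (e^{‖a‖+‖c‖} − 1)‖X‖` — two different exponents (no `‖1‖ = 1`, no commutativity; the equal-exponent case is
`B9Eq370Expansion.norm_conj_sub_le`). [folklore] -/
theorem norm_exp_mul_mul_exp_neg_sub_le (a c X : 𝔸) :
    ‖exp a * X * exp (-c) - X‖ ≤ (Real.exp (‖a‖ + ‖c‖) - 1) * ‖X‖ := by
  have h : exp a * X * exp (-c) - X = (exp a - 1) * X * exp (-c) + X * (exp (-c) - 1) := by noncomm_ring
  have t1 : ‖(exp a - 1) * X * exp (-c)‖ ≤ (Real.exp ‖a‖ - 1) * ‖X‖ * Real.exp ‖c‖ := by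
    calc ‖(exp a - 1) * X * exp (-c)‖ ≤ ‖(exp a - 1) * X‖ * Real.exp ‖-c‖ := B12Membership314.norm_mul_exp_le _ _
      _ ≤ ‖exp a - 1‖ * ‖X‖ * Real.exp ‖c‖ := by rw [norm_neg]; gcongr; exact norm_mul_le _ _
      _ ≤ (Real.exp ‖a‖ - 1) * ‖X‖ * Real.exp ‖c‖ := by gcongr; simpa using norm_exp_sub_one_le_expTail ℂ a
  have t2 : ‖X * (exp (-c) - 1)‖ ≤ ‖X‖ * (Real.exp ‖c‖ - 1) :=
    (norm_mul_le _ _).trans (by gcongr; exact norm_exp_neg_sub_one_le' c)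
  rw [h]
  refine (norm_add_le_of_le t1 t2).trans (le_of_eq ?_)
  rw [Real.exp_add]; ring

/-- **THE DRESSED DIFFERENCE**: `‖e^{c₁}e^{c₂}·X·e^{−c₃}e^{−c₄} − X‖ ≤ (e^{‖c₁‖+‖c₂‖+‖c₃‖+‖c₄‖} − 1)‖X‖` — the background plaquette deviation
`X = U(∂p) − 1` is moved by the four fluctuation exponentials by a RELATIVE amount `e^{ηS(p)} − 1 = O(η|A|)`, which is what gives the
«additional factor α₁» of p. 404 on the `(Mα₀ + α₁)`-part. [folklore] [cite: Balaban1985BackgroundPropagators, p.404 after (3.69)] -/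
theorem norm_dressed_sub_self_le (c₁ c₂ c₃ c₄ X : 𝔸) :
    ‖exp c₁ * exp c₂ * X * exp (-c₃) * exp (-c₄) - X‖ ≤ (Real.exp (‖c₁‖ + ‖c₂‖ + ‖c₃‖ + ‖c₄‖) - 1) * ‖X‖ := by
  set X₁ := exp c₂ * X * exp (-c₃) with hX₁
  have hsplit : exp c₁ * exp c₂ * X * exp (-c₃) * exp (-c₄) - X = (exp c₁ * X₁ * exp (-c₄) - X₁) + (X₁ - X) := by
    rw [hX₁]; noncomm_ring
  have h₁ : ‖X₁ - X‖ ≤ (Real.exp (‖c₂‖ + ‖c₃‖) - 1) * ‖X‖ := norm_exp_mul_mul_exp_neg_sub_le c₂ c₃ X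
  have hX₁n : ‖X₁‖ ≤ Real.exp (‖c₂‖ + ‖c₃‖) * ‖X‖ := by
    have e : X₁ = (X₁ - X) + X := by abel
    rw [e]
    refine (norm_add_le_of_le h₁ le_rfl).trans (le_of_eq (by ring))
  have h₂ : ‖exp c₁ * X₁ * exp (-c₄) - X₁‖ ≤ (Real.exp (‖c₁‖ + ‖c₄‖) - 1) * (Real.exp (‖c₂‖ + ‖c₃‖) * ‖X‖) := by
    refine (norm_exp_mul_mul_exp_neg_sub_le c₁ c₄ X₁).trans (mul_le_mul_of_nonneg_left hX₁n ?_)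
    have := Real.add_one_le_exp (‖c₁‖ + ‖c₄‖)
    linarith [norm_nonneg c₁, norm_nonneg c₄]
  rw [hsplit]
  refine (norm_add_le_of_le h₂ h₁).trans (le_of_eq ?_)
  rw [show ‖c₁‖ + ‖c₂‖ + ‖c₃‖ + ‖c₄‖ = (‖c₁‖ + ‖c₄‖) + (‖c₂‖ + ‖c₃‖) by ring, Real.exp_add (‖c₁‖ + ‖c₄‖)]
  ring

end Dressed

section ReIm

variable {𝔸 : Type*} [NormedRing 𝔸] [NormedAlgebra ℂ 𝔸]

omit [NormedAlgebra ℂ 𝔸] in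
/-- `P′⁻¹ − P⁻¹ = P′⁻¹(P − P′)P⁻¹` for units. [folklore] -/
theorem units_inv_sub_inv (P' P : 𝔸ˣ) :
    ((P'⁻¹ : 𝔸ˣ) : 𝔸) - ((P⁻¹ : 𝔸ˣ) : 𝔸) = ((P'⁻¹ : 𝔸ˣ) : 𝔸) * ((P : 𝔸) - (P' : 𝔸)) * ((P⁻¹ : 𝔸ˣ) : 𝔸) := by
  rw [mul_sub, sub_mul, Units.mul_inv_cancel_right, Units.inv_mul, one_mul]

omit [NormedAlgebra ℂ 𝔸] in
/-- `‖P′⁻¹ − P⁻¹‖ ≤ r′·r·‖P′ − P‖` when `‖P′⁻¹‖ ≤ r′`, `‖P⁻¹‖ ≤ r`. [folklore] -/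
theorem norm_units_inv_sub_inv_le {P' P : 𝔸ˣ} {r' r : ℝ} (hr' : ‖((P'⁻¹ : 𝔸ˣ) : 𝔸)‖ ≤ r') (hr : ‖((P⁻¹ : 𝔸ˣ) : 𝔸)‖ ≤ r) :
    ‖((P'⁻¹ : 𝔸ˣ) : 𝔸) - ((P⁻¹ : 𝔸ˣ) : 𝔸)‖ ≤ r' * r * ‖(P' : 𝔸) - (P : 𝔸)‖ := by
  rw [units_inv_sub_inv]
  calc ‖((P'⁻¹ : 𝔸ˣ) : 𝔸) * ((P : 𝔸) - (P' : 𝔸)) * ((P⁻¹ : 𝔸ˣ) : 𝔸)‖ ≤ r' * ‖(P : 𝔸) - (P' : 𝔸)‖ * r :=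
        norm_mul_le_of_le (norm_mul_le_of_le hr' le_rfl) hr
    _ = r' * r * ‖(P' : 𝔸) - (P : 𝔸)‖ := by rw [norm_sub_rev]; ring

/-- `Re P′ − Re P = ½((P′ − P) + (P′⁻¹ − P⁻¹))` for the complexified `Re W = ½(W + W⁻¹)` of p. 391 (`B9Eq37Insertion.reC`). [folklore]
[cite: Balaban1985BackgroundPropagators, after (3.7) p.391] -/
theorem reC_sub_reC (P' P : 𝔸ˣ) :
    reC P' - reC P = (2 : ℂ)⁻¹ • (((P' : 𝔸) - (P : 𝔸)) + (((P'⁻¹ : 𝔸ˣ) : 𝔸) - ((P⁻¹ : 𝔸ˣ) : 𝔸))) := by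
  rw [reC, reC, ← smul_sub]
  congr 1
  abel

/-- `Im P′ − Im P = (2i)⁻¹((P′ − P) − (P′⁻¹ − P⁻¹))` (`B9Eq37Insertion.imC`). [folklore] [cite: Balaban1985BackgroundPropagators, after (3.7) p.391] -/
theorem imC_sub_imC (P' P : 𝔸ˣ) :
    imC P' - imC P = (2 * I)⁻¹ • (((P' : 𝔸) - (P : 𝔸)) - (((P'⁻¹ : 𝔸ˣ) : 𝔸) - ((P⁻¹ : 𝔸ˣ) : 𝔸))) := by
  rw [imC, imC, ← smul_sub]
  congr 1
  abel

/-- `‖(2i)⁻¹‖ = ½`. [folklore] -/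
theorem norm_two_I_inv : ‖(2 * I : ℂ)⁻¹‖ = 2⁻¹ := by
  rw [norm_inv, Complex.norm_mul, Complex.norm_two, Complex.norm_I, mul_one]

/-- **`|Re P′ − Re P| ≤ ½(1 + r′r)|P′ − P|`** for `‖P′⁻¹‖ ≤ r′`, `‖P⁻¹‖ ≤ r` — the two-plaquette version of the display below (3.69)
(`B9Eq369Small.norm_reC_sub_one_le` is the case `P = 1`). [folklore] [cite: Balaban1985BackgroundPropagators, p.404 below (3.69)] -/
theorem norm_reC_sub_reC_le {P' P : 𝔸ˣ} {r' r : ℝ} (hr' : ‖((P'⁻¹ : 𝔸ˣ) : 𝔸)‖ ≤ r') (hr : ‖((P⁻¹ : 𝔸ˣ) : 𝔸)‖ ≤ r) :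
    ‖reC P' - reC P‖ ≤ (1 + r' * r) / 2 * ‖(P' : 𝔸) - (P : 𝔸)‖ := by
  have e : ‖((P' : 𝔸) - (P : 𝔸)) + (((P'⁻¹ : 𝔸ˣ) : 𝔸) - ((P⁻¹ : 𝔸ˣ) : 𝔸))‖
      ≤ ‖(P' : 𝔸) - (P : 𝔸)‖ + r' * r * ‖(P' : 𝔸) - (P : 𝔸)‖ :=
    norm_add_le_of_le le_rfl (norm_units_inv_sub_inv_le hr' hr)
  rw [reC_sub_reC, norm_smul, norm_two_inv]
  calc 2⁻¹ * ‖((P' : 𝔸) - (P : 𝔸)) + (((P'⁻¹ : 𝔸ˣ) : 𝔸) - ((P⁻¹ : 𝔸ˣ) : 𝔸))‖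
        ≤ 2⁻¹ * (‖(P' : 𝔸) - (P : 𝔸)‖ + r' * r * ‖(P' : 𝔸) - (P : 𝔸)‖) := by gcongr
    _ = (1 + r' * r) / 2 * ‖(P' : 𝔸) - (P : 𝔸)‖ := by ring

/-- **`|Im P′ − Im P| ≤ ½(1 + r′r)|P′ − P|`** likewise (`B9Eq369Small.norm_imC_le` is the case `P = 1`). [folklore]
[cite: Balaban1985BackgroundPropagators, p.404 below (3.69)] -/
theorem norm_imC_sub_imC_le {P' P : 𝔸ˣ} {r' r : ℝ} (hr' : ‖((P'⁻¹ : 𝔸ˣ) : 𝔸)‖ ≤ r') (hr : ‖((P⁻¹ : 𝔸ˣ) : 𝔸)‖ ≤ r) :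
    ‖imC P' - imC P‖ ≤ (1 + r' * r) / 2 * ‖(P' : 𝔸) - (P : 𝔸)‖ := by
  have e : ‖((P' : 𝔸) - (P : 𝔸)) - (((P'⁻¹ : 𝔸ˣ) : 𝔸) - ((P⁻¹ : 𝔸ˣ) : 𝔸))‖
      ≤ ‖(P' : 𝔸) - (P : 𝔸)‖ + r' * r * ‖(P' : 𝔸) - (P : 𝔸)‖ :=
    norm_sub_le_of_le le_rfl (norm_units_inv_sub_inv_le hr' hr)
  rw [imC_sub_imC, norm_smul, norm_two_I_inv]
  calc 2⁻¹ * ‖((P' : 𝔸) - (P : 𝔸)) - (((P'⁻¹ : 𝔸ˣ) : 𝔸) - ((P⁻¹ : 𝔸ˣ) : 𝔸))‖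
        ≤ 2⁻¹ * (‖(P' : 𝔸) - (P : 𝔸)‖ + r' * r * ‖(P' : 𝔸) - (P : 𝔸)‖) := by gcongr
    _ = (1 + r' * r) / 2 * ‖(P' : 𝔸) - (P : 𝔸)‖ := by ring

variable {S : Type*} {ι : Type*} (T : ι → Equiv.Perm S) (U V : ι → S → 𝔸ˣ)

/-- **THE WEIGHT `z(p)` OF TWO CONFIGURATIONS**: `‖z_V(p) − z_U(p)‖ ≤ (η²)⁻¹·½(1 + r′r)·‖V(∂p) − U(∂p)‖` for `‖V(∂p)⁻¹‖ ≤ r′`,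
`‖U(∂p)⁻¹‖ ≤ r` (`z(p) = η⁻²(Re ·(∂p) − 1)`, `B9Eq310Hermitian.zP`). [folklore] [cite: Balaban1985BackgroundPropagators, (3.10) p.392, p.404] -/
theorem norm_zP_sub_zP_le {η r' r Δ : ℝ} {κ ν : ι} {y : S} (hr' : ‖(((plaqU T V κ ν y)⁻¹ : 𝔸ˣ) : 𝔸)‖ ≤ r')
    (hr : ‖(((plaqU T U κ ν y)⁻¹ : 𝔸ˣ) : 𝔸)‖ ≤ r) (hΔ : ‖(plaqU T V κ ν y : 𝔸) - (plaqU T U κ ν y : 𝔸)‖ ≤ Δ) :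
    ‖zP T V η κ ν y - zP T U η κ ν y‖ ≤ (η ^ 2)⁻¹ * ((1 + r' * r) / 2 * Δ) := by
  have h0 : 0 ≤ (1 + r' * r) / 2 := by
    have a := (norm_nonneg _).trans hr'; have b := (norm_nonneg _).trans hr; positivity
  rw [zP, zP, ← smul_sub, sub_sub_sub_cancel_right, norm_smul, norm_eta_inv_sq]
  exact mul_le_mul_of_nonneg_left ((norm_reC_sub_reC_le hr' hr).trans (mul_le_mul_of_nonneg_left hΔ h0))
    (inv_nonneg.mpr (sq_nonneg η))

/-- **THE WEIGHT `y(p)` OF TWO CONFIGURATIONS**: `‖y_V(p) − y_U(p)‖ ≤ (η²)⁻¹·½(1 + r′r)·‖V(∂p) − U(∂p)‖` (`y(p) = η⁻² Im ·(∂p)`,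
`B9Eq310Hermitian.yP`). [folklore] [cite: Balaban1985BackgroundPropagators, (3.10) p.392, p.404] -/
theorem norm_yP_sub_yP_le {η r' r Δ : ℝ} {κ ν : ι} {y : S} (hr' : ‖(((plaqU T V κ ν y)⁻¹ : 𝔸ˣ) : 𝔸)‖ ≤ r')
    (hr : ‖(((plaqU T U κ ν y)⁻¹ : 𝔸ˣ) : 𝔸)‖ ≤ r) (hΔ : ‖(plaqU T V κ ν y : 𝔸) - (plaqU T U κ ν y : 𝔸)‖ ≤ Δ) :
    ‖yP T V η κ ν y - yP T U η κ ν y‖ ≤ (η ^ 2)⁻¹ * ((1 + r' * r) / 2 * Δ) := by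
  have h0 : 0 ≤ (1 + r' * r) / 2 := by
    have a := (norm_nonneg _).trans hr'; have b := (norm_nonneg _).trans hr; positivity
  rw [yP, yP, ← smul_sub, norm_smul, norm_eta_inv_sq]
  exact mul_le_mul_of_nonneg_left ((norm_imC_sub_imC_le hr' hr).trans (mul_le_mul_of_nonneg_left hΔ h0))
    (inv_nonneg.mpr (sq_nonneg η))

end ReIm

/-! ## §2  (3.10) FOR TWO CONFIGURATIONS: `‖(Δ′(V)A)(b) − (Δ′(U)A)(b)‖` from a transport perturbation `σ` and a weight perturbation `θ` -/

section TwoCfg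

variable {𝔸 : Type*} [NormedRing 𝔸] [NormedAlgebra ℂ 𝔸] {S : Type*} {ι : Type*}
variable (T : ι → Equiv.Perm S) (U V : ι → S → 𝔸ˣ)

omit [NormedAlgebra ℂ 𝔸] in
/-- The near letters cancel: `(D_V A)(p) − (D_U A)(p) = (R(V_κ(y)) − R(U_κ(y)))A_ν(y+e_κ) − (R(V_ν(y)) − R(U_ν(y)))A_κ(y+e_ν)`. [folklore]
[cite: Balaban1985BackgroundPropagators, (3.4) p.391] -/
theorem curl_sub_curl (A : ι → S → 𝔸) (κ ν : ι) (y : S) :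
    curl T V A κ ν y - curl T U A κ ν y
      = (R (V κ y) (A ν (T κ y)) - R (U κ y) (A ν (T κ y))) - (R (V ν y) (A κ (T ν y)) - R (U ν y) (A κ (T ν y))) := by
  simp only [curl, covD]
  abel

omit [NormedAlgebra ℂ 𝔸] in
/-- LOCAL `‖(D_V A)(p) − (D_U A)(p)‖ ≤ 2σa` from `‖(R(V(b′)) − R(U(b′)))X‖ ≤ σ‖X‖` and the two far letters `‖A‖ ≤ a`. [folklore]
[cite: Balaban1985BackgroundPropagators, (3.4) p.391] -/
theorem norm_curl_sub_le_loc {σ a : ℝ} (hσ0 : 0 ≤ σ) (hσ : ∀ μ x X, ‖R (V μ x) X - R (U μ x) X‖ ≤ σ * ‖X‖)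
    {A : ι → S → 𝔸} {κ ν : ι} {y : S} (h₂ : ‖A ν (T κ y)‖ ≤ a) (h₃ : ‖A κ (T ν y)‖ ≤ a) :
    ‖curl T V A κ ν y - curl T U A κ ν y‖ ≤ 2 * σ * a := by
  rw [curl_sub_curl]
  exact (norm_sub_le_of_le ((hσ _ _ _).trans (mul_le_mul_of_nonneg_left h₂ hσ0))
    ((hσ _ _ _).trans (mul_le_mul_of_nonneg_left h₃ hσ0))).trans (le_of_eq (by ring))

omit [NormedAlgebra ℂ 𝔸] in
/-- LOCAL `‖S_k^V(p) − S_k^U(p)‖ ≤ 2σa` for the four signed partner sums (only the transported far letters change). [folklore] -/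
theorem norm_sgnSum_sub_le_loc {σ a : ℝ} (hσ0 : 0 ≤ σ) (hσ : ∀ μ x X, ‖R (V μ x) X - R (U μ x) X‖ ≤ σ * ‖X‖)
    {A : ι → S → 𝔸} {κ ν : ι} {y : S} (h₂ : ‖A ν (T κ y)‖ ≤ a) (h₃ : ‖A κ (T ν y)‖ ≤ a) :
    ‖sgnSum₁ T V A κ ν y - sgnSum₁ T U A κ ν y‖ ≤ 2 * σ * a ∧ ‖sgnSum₂ T V A κ ν y - sgnSum₂ T U A κ ν y‖ ≤ 2 * σ * a
      ∧ ‖sgnSum₃ T V A κ ν y - sgnSum₃ T U A κ ν y‖ ≤ 2 * σ * a ∧ ‖sgnSum₄ T V A κ ν y - sgnSum₄ T U A κ ν y‖ ≤ 2 * σ * a := by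
  have ha : 0 ≤ a := (norm_nonneg _).trans h₂
  have l₄ : ‖R (V κ y) (A ν (T κ y)) - R (U κ y) (A ν (T κ y))‖ ≤ σ * a :=
    (hσ _ _ _).trans (mul_le_mul_of_nonneg_left h₂ hσ0)
  have l₁ : ‖R (V ν y) (A κ (T ν y)) - R (U ν y) (A κ (T ν y))‖ ≤ σ * a :=
    (hσ _ _ _).trans (mul_le_mul_of_nonneg_left h₃ hσ0)
  have hσa : 0 ≤ σ * a := mul_nonneg hσ0 ha
  have e₁ : sgnSum₁ T V A κ ν y - sgnSum₁ T U A κ ν y = -(R (V κ y) (A ν (T κ y)) - R (U κ y) (A ν (T κ y))) := by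
    simp only [sgnSum₁]; abel
  have e₂ : sgnSum₂ T V A κ ν y - sgnSum₂ T U A κ ν y
      = -(R (V ν y) (A κ (T ν y)) - R (U ν y) (A κ (T ν y))) - (R (V κ y) (A ν (T κ y)) - R (U κ y) (A ν (T κ y))) := by
    simp only [sgnSum₂]; abel
  have e₃ : sgnSum₃ T V A κ ν y - sgnSum₃ T U A κ ν y
      = -(R (V ν y) (A κ (T ν y)) - R (U ν y) (A κ (T ν y))) - (R (V κ y) (A ν (T κ y)) - R (U κ y) (A ν (T κ y))) := by
    simp only [sgnSum₃]; abel
  have e₄ : sgnSum₄ T V A κ ν y - sgnSum₄ T U A κ ν y = -(R (V ν y) (A κ (T ν y)) - R (U ν y) (A κ (T ν y))) := by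
    simp only [sgnSum₄]; abel
  have l₁' : ‖-(R (V ν y) (A κ (T ν y)) - R (U ν y) (A κ (T ν y)))‖ ≤ σ * a := by rw [norm_neg]; exact l₁
  have l₄' : ‖-(R (V κ y) (A ν (T κ y)) - R (U κ y) (A ν (T κ y)))‖ ≤ σ * a := by rw [norm_neg]; exact l₄
  refine ⟨?_, ?_, ?_, ?_⟩
  · rw [e₁]; linarith
  · rw [e₂]; exact (norm_sub_le_of_le l₁' l₄).trans (le_of_eq (by ring))
  · rw [e₃]; exact (norm_sub_le_of_le l₁' l₄).trans (le_of_eq (by ring))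
  · rw [e₄]; linarith

/-- Polarisation of the Jordan product's difference: `½(cz + zc) − ½(c′z′ + z′c′) = ½((c − c′)z + c′(z − z′) + (z − z′)c + z′(c − c′))`.
[folklore] -/
theorem jordan_sub (c c' z z' : 𝔸) :
    (2 : ℂ)⁻¹ • (c * z + z * c) - (2 : ℂ)⁻¹ • (c' * z' + z' * c')
      = (2 : ℂ)⁻¹ • ((c - c') * z + c' * (z - z') + (z - z') * c + z' * (c - c')) := by
  rw [← smul_sub]
  congr 1
  noncomm_ring

/-- Polarisation of the commutator's difference: `(i/2)(yX − Xy) − (i/2)(y′X′ − X′y′) = (i/2)((y − y′)X + y′(X − X′) − (X − X′)y − X′(y − y′))`.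
[folklore] -/
theorem comm_sub (w w' X X' : 𝔸) :
    (I / 2) • (w * X - X * w) - (I / 2) • (w' * X' - X' * w')
      = (I / 2) • ((w - w') * X + w' * (X - X') - (X - X') * w - X' * (w - w')) := by
  rw [← smul_sub]
  congr 1
  noncomm_ring

/-- `‖½(PQ + … four products)‖`-type estimate: `‖½ • (W₁ + W₂ + W₃ + W₄)‖ ≤ ½(‖W₁‖ + ‖W₂‖ + ‖W₃‖ + ‖W₄‖)`. [folklore] -/
theorem norm_half_smul_four_le (W₁ W₂ W₃ W₄ : 𝔸) :
    ‖(2 : ℂ)⁻¹ • (W₁ + W₂ + W₃ + W₄)‖ ≤ 2⁻¹ * (‖W₁‖ + ‖W₂‖ + ‖W₃‖ + ‖W₄‖) := by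
  rw [norm_smul, norm_two_inv]
  gcongr
  exact norm_add_le_of_le (norm_add_le_of_le (norm_add_le _ _) le_rfl) le_rfl

/-- `‖(i/2) • (W₁ + W₂ − W₃ − W₄)‖ ≤ ½(‖W₁‖ + ‖W₂‖ + ‖W₃‖ + ‖W₄‖)`. [folklore] -/
theorem norm_I_half_smul_four_le (W₁ W₂ W₃ W₄ : 𝔸) :
    ‖(I / 2) • (W₁ + W₂ - W₃ - W₄)‖ ≤ 2⁻¹ * (‖W₁‖ + ‖W₂‖ + ‖W₃‖ + ‖W₄‖) := by
  have hI : ‖I / 2‖ = 2⁻¹ := by rw [norm_div, Complex.norm_I, Complex.norm_two, one_div]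
  rw [norm_smul, hI]
  gcongr
  exact norm_sub_le_of_le (norm_sub_le_of_le (norm_add_le _ _) le_rfl) le_rfl

/-- **THE JORDAN LETTER FUNCTION OF TWO CONFIGURATIONS**, locally: with transports `‖U(b′)^{±1}‖, ‖V(b′)^{±1}‖ ≤ ρ` (`1 ≤ ρ`), the
transport perturbation `‖(R(V(b′)) − R(U(b′)))X‖ ≤ σ‖X‖`, the four letters `‖A(b′)‖ ≤ a`, `b′ ⊂ ∂p`, the weights `‖z_U(p)‖, ‖z_V(p)‖ ≤ δ`
and `‖z_V(p) − z_U(p)‖ ≤ θ`: `‖F^J_{V,A}(p) − F^J_{U,A}(p)‖ ≤ 2σaδ + 4ρ²aθ`. [folklore] [cite: Balaban1985BackgroundPropagators, (3.10) p.392] -/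
theorem norm_jordanF_sub_le_loc {ρ σ : ℝ} (hρ : 1 ≤ ρ)
    (hUρ : ∀ μ x, ‖(U μ x : 𝔸)‖ ≤ ρ ∧ ‖(((U μ x)⁻¹ : 𝔸ˣ) : 𝔸)‖ ≤ ρ)
    (hVρ : ∀ μ x, ‖(V μ x : 𝔸)‖ ≤ ρ ∧ ‖(((V μ x)⁻¹ : 𝔸ˣ) : 𝔸)‖ ≤ ρ) (hσ0 : 0 ≤ σ)
    (hσ : ∀ μ x X, ‖R (V μ x) X - R (U μ x) X‖ ≤ σ * ‖X‖)
    {A : ι → S → 𝔸} {a : ℝ} {κ ν : ι} {y : S} (h₁ : ‖A κ y‖ ≤ a) (h₂ : ‖A ν (T κ y)‖ ≤ a) (h₃ : ‖A κ (T ν y)‖ ≤ a)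
    (h₄ : ‖A ν y‖ ≤ a) {η δ θ : ℝ} (hzU : ‖zP T U η κ ν y‖ ≤ δ) (hzV : ‖zP T V η κ ν y‖ ≤ δ)
    (hθ : ‖zP T V η κ ν y - zP T U η κ ν y‖ ≤ θ) :
    ‖jordanF T V η A κ ν y - jordanF T U η A κ ν y‖ ≤ 2 * σ * a * δ + 4 * ρ ^ 2 * a * θ := by
  have cU := norm_curl_le_loc T U hρ hUρ h₁ h₂ h₃ h₄
  have cV := norm_curl_le_loc T V hρ hVρ h₁ h₂ h₃ h₄
  have cd := norm_curl_sub_le_loc T U V hσ0 hσ h₂ h₃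
  have hδ : 0 ≤ δ := (norm_nonneg _).trans hzU
  have hθ0 : 0 ≤ θ := (norm_nonneg _).trans hθ
  have hc0 : 0 ≤ 4 * ρ ^ 2 * a := (norm_nonneg _).trans cU
  have hd0 : 0 ≤ 2 * σ * a := (norm_nonneg _).trans cd
  unfold jordanF
  rw [jordan_sub]
  refine (norm_half_smul_four_le _ _ _ _).trans ?_
  have t₁ := norm_mul_le_of_le cd hzV
  have t₂ := norm_mul_le_of_le cU hθ
  have t₃ := norm_mul_le_of_le hθ cV
  have t₄ := norm_mul_le_of_le hzU cd
  nlinarith [t₁, t₂, t₃, t₄]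

/-- **THE COMMUTATOR LETTER FUNCTIONS OF TWO CONFIGURATIONS**, locally, all four slots: `‖G_k^V(p) − G_k^U(p)‖ ≤ 3ρ²aθ + 2σaδ` with
`‖y_U(p)‖, ‖y_V(p)‖ ≤ δ`, `‖y_V(p) − y_U(p)‖ ≤ θ`. [folklore] [cite: Balaban1985BackgroundPropagators, (3.10) p.392] -/
theorem norm_commG_sub_le_loc {ρ σ : ℝ} (hρ : 1 ≤ ρ)
    (hUρ : ∀ μ x, ‖(U μ x : 𝔸)‖ ≤ ρ ∧ ‖(((U μ x)⁻¹ : 𝔸ˣ) : 𝔸)‖ ≤ ρ)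
    (hVρ : ∀ μ x, ‖(V μ x : 𝔸)‖ ≤ ρ ∧ ‖(((V μ x)⁻¹ : 𝔸ˣ) : 𝔸)‖ ≤ ρ) (hσ0 : 0 ≤ σ)
    (hσ : ∀ μ x X, ‖R (V μ x) X - R (U μ x) X‖ ≤ σ * ‖X‖)
    {A : ι → S → 𝔸} {a : ℝ} {κ ν : ι} {y : S} (h₁ : ‖A κ y‖ ≤ a) (h₂ : ‖A ν (T κ y)‖ ≤ a) (h₃ : ‖A κ (T ν y)‖ ≤ a)
    (h₄ : ‖A ν y‖ ≤ a) {η δ θ : ℝ} (hyU : ‖yP T U η κ ν y‖ ≤ δ) (hyV : ‖yP T V η κ ν y‖ ≤ δ)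
    (hθ : ‖yP T V η κ ν y - yP T U η κ ν y‖ ≤ θ) :
    ‖commG₁ T V η A κ ν y - commG₁ T U η A κ ν y‖ ≤ 3 * ρ ^ 2 * a * θ + 2 * σ * a * δ
      ∧ ‖commG₂ T V η A κ ν y - commG₂ T U η A κ ν y‖ ≤ 3 * ρ ^ 2 * a * θ + 2 * σ * a * δ
      ∧ ‖commG₃ T V η A κ ν y - commG₃ T U η A κ ν y‖ ≤ 3 * ρ ^ 2 * a * θ + 2 * σ * a * δ
      ∧ ‖commG₄ T V η A κ ν y - commG₄ T U η A κ ν y‖ ≤ 3 * ρ ^ 2 * a * θ + 2 * σ * a * δ := by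
  obtain ⟨sU₁, sU₂, sU₃, sU₄⟩ := norm_sgnSum_le_loc T U hρ hUρ h₁ h₂ h₃ h₄
  obtain ⟨sV₁, sV₂, sV₃, sV₄⟩ := norm_sgnSum_le_loc T V hρ hVρ h₁ h₂ h₃ h₄
  obtain ⟨d₁, d₂, d₃, d₄⟩ := norm_sgnSum_sub_le_loc T U V hσ0 hσ h₂ h₃
  have hδ : 0 ≤ δ := (norm_nonneg _).trans hyU
  have hθ0 : 0 ≤ θ := (norm_nonneg _).trans hθ
  have hs0 : 0 ≤ 3 * ρ ^ 2 * a := (norm_nonneg _).trans sU₁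
  have hd0 : 0 ≤ 2 * σ * a := (norm_nonneg _).trans d₁
  have key : ∀ (X X' : 𝔸), ‖X‖ ≤ 3 * ρ ^ 2 * a → ‖X'‖ ≤ 3 * ρ ^ 2 * a → ‖X - X'‖ ≤ 2 * σ * a →
      ‖(I / 2) • (yP T V η κ ν y * X - X * yP T V η κ ν y) - (I / 2) • (yP T U η κ ν y * X' - X' * yP T U η κ ν y)‖
        ≤ 3 * ρ ^ 2 * a * θ + 2 * σ * a * δ := by
    intro X X' hX hX' hXX'
    rw [comm_sub]
    refine (norm_I_half_smul_four_le _ _ _ _).trans ?_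
    have t₁ := norm_mul_le_of_le hθ hX
    have t₂ := norm_mul_le_of_le hyU hXX'
    have t₃ := norm_mul_le_of_le hXX' hyV
    have t₄ := norm_mul_le_of_le hX' hθ
    nlinarith [t₁, t₂, t₃, t₄]
  exact ⟨key _ _ sV₁ sU₁ d₁, key _ _ sV₂ sU₂ d₂, key _ _ sV₃ sU₃ d₃, key _ _ sV₄ sU₄ d₄⟩

variable [Fintype ι] [LinearOrder ι]

omit [NormedAlgebra ℂ 𝔸] in
/-- **THE LETTER DIVERGENCE OF TWO CONFIGURATIONS**, locally: if on the plaquettes THROUGH `b` the letter functions satisfy `‖G_k(p)‖ ≤ g`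
and `‖H_k(p) − G_k(p)‖ ≤ γ`, the transports `‖V(b′)^{±1}‖ ≤ ρ` and `‖(R(V(b′))⁻¹ − R(U(b′))⁻¹)X‖ ≤ σ‖X‖`, then
`‖(÷_V H)(b) − (÷_U G)(b)‖ ≤ (2ρ²γ + σg)(d − 1)`. [folklore] [cite: Balaban1985BackgroundPropagators, (3.9) p.392] -/
theorem norm_divL_sub_le_loc {ρ σ : ℝ} (hρ : 1 ≤ ρ)
    (hVρ : ∀ μ x, ‖(V μ x : 𝔸)‖ ≤ ρ ∧ ‖(((V μ x)⁻¹ : 𝔸ˣ) : 𝔸)‖ ≤ ρ) (hσ0 : 0 ≤ σ)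
    (hσ' : ∀ μ x X, ‖R (V μ x)⁻¹ X - R (U μ x)⁻¹ X‖ ≤ σ * ‖X‖)
    {G₁ G₂ G₃ G₄ H₁ H₂ H₃ H₄ : ι → ι → S → 𝔸} {g γ : ℝ} (μ : ι) (x : S)
    (hG : ∀ κ ν y, Through T μ x κ ν y → ‖G₁ κ ν y‖ ≤ g ∧ ‖G₂ κ ν y‖ ≤ g ∧ ‖G₃ κ ν y‖ ≤ g ∧ ‖G₄ κ ν y‖ ≤ g)
    (hH : ∀ κ ν y, Through T μ x κ ν y → ‖H₁ κ ν y - G₁ κ ν y‖ ≤ γ ∧ ‖H₂ κ ν y - G₂ κ ν y‖ ≤ γ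
      ∧ ‖H₃ κ ν y - G₃ κ ν y‖ ≤ γ ∧ ‖H₄ κ ν y - G₄ κ ν y‖ ≤ γ) :
    ‖divL T V H₁ H₂ H₃ H₄ μ x - divL T U G₁ G₂ G₃ G₄ μ x‖ ≤ (2 * ρ ^ 2 * γ + σ * g) * ((Fintype.card ι - 1 : ℕ) : ℝ) := by
  have key : ∀ (b : ι × S) (P P' Q Q' : 𝔸), ‖P‖ ≤ g → ‖P' - P‖ ≤ γ → ‖Q' - Q‖ ≤ γ →
      ‖(R (V b.1 b.2)⁻¹ P' - Q') - (R (U b.1 b.2)⁻¹ P - Q)‖ ≤ 2 * ρ ^ 2 * γ + σ * g := by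
    intro b P P' Q Q' hP0 hP hQ'
    have hγ : 0 ≤ γ := (norm_nonneg _).trans hP
    have e : (R (V b.1 b.2)⁻¹ P' - Q') - (R (U b.1 b.2)⁻¹ P - Q)
        = R (V b.1 b.2)⁻¹ (P' - P) + (R (V b.1 b.2)⁻¹ P - R (U b.1 b.2)⁻¹ P) - (Q' - Q) := by
      rw [R_sub]; abel
    rw [e]
    have t₁ : ‖R (V b.1 b.2)⁻¹ (P' - P)‖ ≤ ρ ^ 2 * γ :=
      (norm_R_inv_le_rho (hVρ _ _).1 (hVρ _ _).2 _).trans (mul_le_mul_of_nonneg_left hP (sq_nonneg ρ))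
    have t₂ : ‖R (V b.1 b.2)⁻¹ P - R (U b.1 b.2)⁻¹ P‖ ≤ σ * g := (hσ' _ _ _).trans (mul_le_mul_of_nonneg_left hP0 hσ0)
    have t₃ : ‖Q' - Q‖ ≤ ρ ^ 2 * γ := hQ'.trans (le_rho_sq_mul hρ hγ)
    exact (norm_sub_le_of_le (norm_add_le_of_le t₁ t₂) t₃).trans (le_of_eq (by ring))
  have h1 : ∀ ν, ‖(if ν < μ then R (V ν ((T ν).symm x))⁻¹ (H₄ ν μ ((T ν).symm x)) - H₂ ν μ x else 0)
      - (if ν < μ then R (U ν ((T ν).symm x))⁻¹ (G₄ ν μ ((T ν).symm x)) - G₂ ν μ x else 0)‖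
      ≤ if ν < μ then 2 * ρ ^ 2 * γ + σ * g else 0 := by
    intro ν
    split_ifs with h
    · have t₁ : Through T μ x ν μ ((T ν).symm x) := ⟨h, Or.inl ⟨rfl, Or.inr rfl⟩⟩
      have t₂ : Through T μ x ν μ x := ⟨h, Or.inl ⟨rfl, Or.inl rfl⟩⟩
      exact key (ν, (T ν).symm x) _ _ _ _ (hG _ _ _ t₁).2.2.2 (hH _ _ _ t₁).2.2.2 (hH _ _ _ t₂).2.1
    · rw [sub_zero, norm_zero]
  have h2 : ∀ ν, ‖(if μ < ν then R (V ν ((T ν).symm x))⁻¹ (H₁ μ ν ((T ν).symm x)) - H₃ μ ν x else 0)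
      - (if μ < ν then R (U ν ((T ν).symm x))⁻¹ (G₁ μ ν ((T ν).symm x)) - G₃ μ ν x else 0)‖
      ≤ if μ < ν then 2 * ρ ^ 2 * γ + σ * g else 0 := by
    intro ν
    split_ifs with h
    · have t₁ : Through T μ x μ ν ((T ν).symm x) := ⟨h, Or.inr ⟨rfl, Or.inr rfl⟩⟩
      have t₂ : Through T μ x μ ν x := ⟨h, Or.inr ⟨rfl, Or.inl rfl⟩⟩
      exact key (ν, (T ν).symm x) _ _ _ _ (hG _ _ _ t₁).1 (hH _ _ _ t₁).1 (hH _ _ _ t₂).2.2.1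
    · rw [sub_zero, norm_zero]
  unfold divL
  rw [sub_sub_sub_comm, ← Finset.sum_sub_distrib, ← Finset.sum_sub_distrib]
  refine (norm_sub_le _ _).trans ?_
  refine (add_le_add ((norm_sum_le _ _).trans (Finset.sum_le_sum fun ν _ => h1 ν))
    ((norm_sum_le _ _).trans (Finset.sum_le_sum fun ν _ => h2 ν))).trans ?_
  rw [sum_ite_lt_add_sum_ite_gt μ (2 * ρ ^ 2 * γ + σ * g)]

/-- **(3.10) FOR TWO CONFIGURATIONS — THE LOCAL DIFFERENCE BOUND FOR `Δ′`.**  Let `U`, `V` be bond configurations with `‖U(b′)^{±1}‖,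
‖V(b′)^{±1}‖ ≤ ρ` (`1 ≤ ρ`) whose transports differ by `σ ≥ 0`: `‖(R(V(b′)) − R(U(b′)))X‖, ‖(R(V(b′))⁻¹ − R(U(b′))⁻¹)X‖ ≤ σ‖X‖`.  If on
every positively oriented plaquette `p` THROUGH the bond `b = ⟨x, x+e_μ⟩`: `‖A(b′)‖ ≤ a` on the four bonds `b′ ⊂ ∂p`, the weights of both
configurations satisfy `‖z(p)‖, ‖y(p)‖ ≤ δ`, and they differ by `‖z_V(p) − z_U(p)‖, ‖y_V(p) − y_U(p)‖ ≤ θ`, then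
`‖(Δ′(V)A)(b) − (Δ′(U)A)(b)‖ ≤ (14ρ⁴θ + 15ρ²σδ)(d − 1)·a` — the operator `Δ′` of (3.10) (`B9Eq310Hermitian.deltaPrimeOp`) is Lipschitz in
the configuration through its transports and its plaquette weights; `B9Eq369Small.norm_deltaPrimeOp_le_local` is the one-configuration
bound `14ρ⁴(d − 1)aδ`. [folklore] [cite: Balaban1985BackgroundPropagators, (3.10) p.392, p.404 after (3.69)] -/
theorem norm_deltaPrimeOp_sub_le_local {ρ σ : ℝ} (hρ : 1 ≤ ρ)
    (hUρ : ∀ μ x, ‖(U μ x : 𝔸)‖ ≤ ρ ∧ ‖(((U μ x)⁻¹ : 𝔸ˣ) : 𝔸)‖ ≤ ρ)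
    (hVρ : ∀ μ x, ‖(V μ x : 𝔸)‖ ≤ ρ ∧ ‖(((V μ x)⁻¹ : 𝔸ˣ) : 𝔸)‖ ≤ ρ) (hσ0 : 0 ≤ σ)
    (hσ : ∀ μ x X, ‖R (V μ x) X - R (U μ x) X‖ ≤ σ * ‖X‖)
    (hσ' : ∀ μ x X, ‖R (V μ x)⁻¹ X - R (U μ x)⁻¹ X‖ ≤ σ * ‖X‖)
    {A : ι → S → 𝔸} {η a δ θ : ℝ} (μ : ι) (x : S)
    (hA : ∀ κ ν y, Through T μ x κ ν y → ‖A κ y‖ ≤ a ∧ ‖A ν (T κ y)‖ ≤ a ∧ ‖A κ (T ν y)‖ ≤ a ∧ ‖A ν y‖ ≤ a)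
    (hz : ∀ κ ν y, Through T μ x κ ν y →
      ‖zP T U η κ ν y‖ ≤ δ ∧ ‖zP T V η κ ν y‖ ≤ δ ∧ ‖zP T V η κ ν y - zP T U η κ ν y‖ ≤ θ)
    (hy : ∀ κ ν y, Through T μ x κ ν y →
      ‖yP T U η κ ν y‖ ≤ δ ∧ ‖yP T V η κ ν y‖ ≤ δ ∧ ‖yP T V η κ ν y - yP T U η κ ν y‖ ≤ θ) :
    ‖deltaPrimeOp T V η A μ x - deltaPrimeOp T U η A μ x‖
      ≤ (14 * ρ ^ 4 * θ + 15 * ρ ^ 2 * σ * δ) * a * ((Fintype.card ι - 1 : ℕ) : ℝ) := by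
  -- the Jordan part: `g_J = 4ρ²aδ`, `γ_J = 2σaδ + 4ρ²aθ`
  have hJg : ∀ κ ν y, Through T μ x κ ν y → ‖jordanF T U η A κ ν y‖ ≤ 4 * ρ ^ 2 * a * δ ∧
      ‖jordanF T U η A κ ν y‖ ≤ 4 * ρ ^ 2 * a * δ ∧ ‖jordanF T U η A κ ν y‖ ≤ 4 * ρ ^ 2 * a * δ ∧
      ‖jordanF T U η A κ ν y‖ ≤ 4 * ρ ^ 2 * a * δ := by
    intro κ ν y h
    obtain ⟨h₁, h₂, h₃, h₄⟩ := hA κ ν y h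
    have e := norm_jordanF_le_loc T U hρ hUρ h₁ h₂ h₃ h₄ (hz κ ν y h).1
    exact ⟨e, e, e, e⟩
  have hJγ : ∀ κ ν y, Through T μ x κ ν y →
      ‖jordanF T V η A κ ν y - jordanF T U η A κ ν y‖ ≤ 2 * σ * a * δ + 4 * ρ ^ 2 * a * θ ∧
      ‖jordanF T V η A κ ν y - jordanF T U η A κ ν y‖ ≤ 2 * σ * a * δ + 4 * ρ ^ 2 * a * θ ∧
      ‖jordanF T V η A κ ν y - jordanF T U η A κ ν y‖ ≤ 2 * σ * a * δ + 4 * ρ ^ 2 * a * θ ∧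
      ‖jordanF T V η A κ ν y - jordanF T U η A κ ν y‖ ≤ 2 * σ * a * δ + 4 * ρ ^ 2 * a * θ := by
    intro κ ν y h
    obtain ⟨h₁, h₂, h₃, h₄⟩ := hA κ ν y h
    obtain ⟨zU, zV, zθ⟩ := hz κ ν y h
    have e := norm_jordanF_sub_le_loc T U V hρ hUρ hVρ hσ0 hσ h₁ h₂ h₃ h₄ zU zV zθ
    exact ⟨e, e, e, e⟩
  -- the commutator part: `g_G = 3ρ²aδ`, `γ_G = 3ρ²aθ + 2σaδ`
  have hGg : ∀ κ ν y, Through T μ x κ ν y → ‖commG₁ T U η A κ ν y‖ ≤ 3 * ρ ^ 2 * a * δ ∧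
      ‖commG₂ T U η A κ ν y‖ ≤ 3 * ρ ^ 2 * a * δ ∧ ‖commG₃ T U η A κ ν y‖ ≤ 3 * ρ ^ 2 * a * δ ∧
      ‖commG₄ T U η A κ ν y‖ ≤ 3 * ρ ^ 2 * a * δ := by
    intro κ ν y h
    obtain ⟨h₁, h₂, h₃, h₄⟩ := hA κ ν y h
    exact norm_commG_le_loc T U hρ hUρ h₁ h₂ h₃ h₄ (hy κ ν y h).1
  have hGγ : ∀ κ ν y, Through T μ x κ ν y →
      ‖commG₁ T V η A κ ν y - commG₁ T U η A κ ν y‖ ≤ 3 * ρ ^ 2 * a * θ + 2 * σ * a * δ ∧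
      ‖commG₂ T V η A κ ν y - commG₂ T U η A κ ν y‖ ≤ 3 * ρ ^ 2 * a * θ + 2 * σ * a * δ ∧
      ‖commG₃ T V η A κ ν y - commG₃ T U η A κ ν y‖ ≤ 3 * ρ ^ 2 * a * θ + 2 * σ * a * δ ∧
      ‖commG₄ T V η A κ ν y - commG₄ T U η A κ ν y‖ ≤ 3 * ρ ^ 2 * a * θ + 2 * σ * a * δ := by
    intro κ ν y h
    obtain ⟨h₁, h₂, h₃, h₄⟩ := hA κ ν y h
    obtain ⟨yU, yV, yθ⟩ := hy κ ν y h
    exact norm_commG_sub_le_loc T U V hρ hUρ hVρ hσ0 hσ h₁ h₂ h₃ h₄ yU yV yθ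
  have eJ := norm_divL_sub_le_loc T U V hρ hVρ hσ0 hσ' μ x hJg hJγ
  have eG := norm_divL_sub_le_loc T U V hρ hVρ hσ0 hσ' μ x hGg hGγ
  have e : deltaPrimeOp T V η A μ x - deltaPrimeOp T U η A μ x
      = (divL T V (jordanF T V η A) (jordanF T V η A) (jordanF T V η A) (jordanF T V η A) μ x
          - divL T U (jordanF T U η A) (jordanF T U η A) (jordanF T U η A) (jordanF T U η A) μ x)
        + (divL T V (commG₁ T V η A) (commG₂ T V η A) (commG₃ T V η A) (commG₄ T V η A) μ x
          - divL T U (commG₁ T U η A) (commG₂ T U η A) (commG₃ T U η A) (commG₄ T U η A) μ x) := by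
    simp only [deltaPrimeOp, divL_self]
    abel
  rw [e]
  exact (norm_add_le_of_le eJ eG).trans (le_of_eq (by ring))

end TwoCfg


/-! ## §3  `V = U′U`: the transport perturbation `σ = O(η|A|)`, the plaquette difference `(U′U)(∂p) − U(∂p)`, the printed letters -/

section ProdCfg

variable {𝔸 : Type*} [NormedRing 𝔸] [NormedAlgebra ℂ 𝔸] [CompleteSpace 𝔸] {S : Type*} {ι : Type*}
variable (T : ι → Equiv.Perm S) (U : ι → S → 𝔸ˣ)

/-- **THE TRANSPORTS OF `U′U` AND `U` DIFFER BY `O(η|A|)`**: with `η‖A(b′)‖ ≤ s` and `‖U(b′)^{±1}‖ ≤ ρ`,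
`‖(R((U′U)(b′)) − R(U(b′)))X‖, ‖(R((U′U)(b′))⁻¹ − R(U(b′))⁻¹)X‖ ≤ ρ²(e^{2s} − 1)‖X‖` — `R(U′(b′)) = exp ηi ad_{A(b′)} = 1 + O(η|A|)`
(`B9Eq370Expansion.R_fluct`, `R_inv_prodCfg`, `norm_conj_sub_le` BY NAME). [folklore] [cite: Balaban1985BackgroundPropagators, p.405 «R(U′) = exp ηiad_A»] -/
theorem norm_R_prodCfg_sub_le {η s ρ : ℝ} (hη : 0 ≤ η) {A : ι → S → 𝔸} (hs : ∀ μ x, η * ‖A μ x‖ ≤ s)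
    (hUρ : ∀ μ x, ‖(U μ x : 𝔸)‖ ≤ ρ ∧ ‖(((U μ x)⁻¹ : 𝔸ˣ) : 𝔸)‖ ≤ ρ) (μ : ι) (x : S) (X : 𝔸) :
    ‖R (prodCfg U η A μ x) X - R (U μ x) X‖ ≤ ρ ^ 2 * (Real.exp (2 * s) - 1) * ‖X‖
      ∧ ‖R (prodCfg U η A μ x)⁻¹ X - R (U μ x)⁻¹ X‖ ≤ ρ ^ 2 * (Real.exp (2 * s) - 1) * ‖X‖ := by
  have hb : ‖((I * η : ℂ)) • A μ x‖ ≤ s := by rw [B12Membership314.norm_I_mul_smul hη]; exact hs μ x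
  have hs0 : 0 ≤ s := (norm_nonneg _).trans hb
  have hE : Real.exp (2 * ‖((I * η : ℂ)) • A μ x‖) - 1 ≤ Real.exp (2 * s) - 1 :=
    sub_le_sub_right (Real.exp_le_exp.mpr (by linarith)) 1
  have hE0 : 0 ≤ Real.exp (2 * s) - 1 := by linarith [Real.add_one_le_exp (2 * s)]
  have hρ2 := norm_R_le_rho (hUρ μ x).1 (hUρ μ x).2 X
  refine ⟨?_, ?_⟩
  · have e : R (prodCfg U η A μ x) X
        = exp (((I * η : ℂ)) • A μ x) * R (U μ x) X * exp (-(((I * η : ℂ)) • A μ x)) := by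
      rw [show prodCfg U η A μ x = fluct η A μ x * U μ x from rfl, B9Eq39Adjoint.R_mul, R_fluct]
    rw [e]
    calc ‖exp (((I * η : ℂ)) • A μ x) * R (U μ x) X * exp (-(((I * η : ℂ)) • A μ x)) - R (U μ x) X‖
          ≤ (Real.exp (2 * ‖((I * η : ℂ)) • A μ x‖) - 1) * ‖R (U μ x) X‖ := norm_conj_sub_le _ _
      _ ≤ (Real.exp (2 * s) - 1) * (ρ ^ 2 * ‖X‖) := mul_le_mul hE hρ2 (norm_nonneg _) hE0
      _ = ρ ^ 2 * (Real.exp (2 * s) - 1) * ‖X‖ := by ring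
  · have hc : ‖exp (-(((I * η : ℂ)) • A μ x)) * X * exp (((I * η : ℂ)) • A μ x) - X‖
        ≤ (Real.exp (2 * ‖((I * η : ℂ)) • A μ x‖) - 1) * ‖X‖ := by
      have h := norm_conj_sub_le (-(((I * η : ℂ)) • A μ x)) X
      rwa [neg_neg, norm_neg] at h
    rw [R_inv_prodCfg, ← R_sub]
    calc ‖R (U μ x)⁻¹ (exp (-(((I * η : ℂ)) • A μ x)) * X * exp (((I * η : ℂ)) • A μ x) - X)‖
          ≤ ρ ^ 2 * ‖exp (-(((I * η : ℂ)) • A μ x)) * X * exp (((I * η : ℂ)) • A μ x) - X‖ :=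
          norm_R_inv_le_rho (hUρ μ x).1 (hUρ μ x).2 _
      _ ≤ ρ ^ 2 * ((Real.exp (2 * s) - 1) * ‖X‖) :=
          mul_le_mul_of_nonneg_left (hc.trans (mul_le_mul_of_nonneg_right hE (norm_nonneg _))) (sq_nonneg ρ)
      _ = ρ ^ 2 * (Real.exp (2 * s) - 1) * ‖X‖ := by ring

/-- **THE DRESSED WORD MINUS ITS MIDDLE LETTER** (pure algebra): for `H₁, …, H₄, P` in a complete normed ℂ-algebra and `ξ ≥ 0`,
`‖e^{iξH₁}e^{iξH₂}·P·e^{−iξH₃}e^{−iξH₄} − P‖ ≤ ξ‖(H₂ − H₄) − (H₃ − H₁)‖ + ½S²ξ²e^{ξS} + (e^{ξS} − 1)‖P − 1‖`, `S = Σ‖H_i‖` — the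
linear term of the pure-fluctuation holonomy, its second-order remainder (`B12Plaquette343.elem343` BY NAME), and the RELATIVE dressing of
`P − 1` (§1). Compare `B12Membership314.norm_plaquette_expMul_sub_one_le` (the word minus `1`, last term `e^{ξS}‖P − 1‖`). [folklore]
[cite: Balaban1985BackgroundPropagators, p.404 after (3.69)] -/
theorem norm_dressed_sub_le {ξ : ℝ} (hξ : 0 ≤ ξ) (H₁ H₂ H₃ H₄ P : 𝔸) :
    ‖exp ((I * ξ) • H₁) * exp ((I * ξ) • H₂) * P * exp (-((I * ξ) • H₃)) * exp (-((I * ξ) • H₄)) - P‖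
      ≤ ξ * ‖(H₂ - H₄) - (H₃ - H₁)‖
        + 1 / 2 * (‖H₁‖ + ‖H₂‖ + ‖H₃‖ + ‖H₄‖) ^ 2 * ξ ^ 2 * Real.exp (ξ * (‖H₁‖ + ‖H₂‖ + ‖H₃‖ + ‖H₄‖))
        + (Real.exp (ξ * (‖H₁‖ + ‖H₂‖ + ‖H₃‖ + ‖H₄‖)) - 1) * ‖P - 1‖ := by
  set S := ‖H₁‖ + ‖H₂‖ + ‖H₃‖ + ‖H₄‖ with hS
  have e : exp ((I * ξ) • H₁) * exp ((I * ξ) • H₂) * P * exp (-((I * ξ) • H₃)) * exp (-((I * ξ) • H₄)) - P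
      = (exp ((I * ξ) • H₁) * exp ((I * ξ) • H₂) * (P - 1) * exp (-((I * ξ) • H₃)) * exp (-((I * ξ) • H₄)) - (P - 1))
        + (holonomy [(I * ξ) • H₁, (I * ξ) • H₂, -((I * ξ) • H₃), -((I * ξ) • H₄)] - 1) := by
    rw [← B12Membership314.dressed_sub_holonomy]; abel
  have hexp : ‖(I * ξ) • H₁‖ + ‖(I * ξ) • H₂‖ + ‖(I * ξ) • H₃‖ + ‖(I * ξ) • H₄‖ = ξ * S := by
    simp only [B12Membership314.norm_I_mul_smul hξ, hS]; ring
  have b1 : ‖exp ((I * ξ) • H₁) * exp ((I * ξ) • H₂) * (P - 1) * exp (-((I * ξ) • H₃)) * exp (-((I * ξ) • H₄)) - (P - 1)‖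
      ≤ (Real.exp (ξ * S) - 1) * ‖P - 1‖ := by
    have h := norm_dressed_sub_self_le ((I * ξ) • H₁) ((I * ξ) • H₂) ((I * ξ) • H₃) ((I * ξ) • H₄) (P - 1)
    rwa [hexp] at h
  have hlin : holonomy [(I * ξ) • H₁, (I * ξ) • H₂, -((I * ξ) • H₃), -((I * ξ) • H₄)] - 1
      = (holonomy [(I * ξ) • H₁, (I * ξ) • H₂, -((I * ξ) • H₃), -((I * ξ) • H₄)] - 1 - (I * ξ) • (H₁ + H₂ - H₃ - H₄))
        + (I * ξ) • (H₁ + H₂ - H₃ - H₄) := by abel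
  have b2 : ‖holonomy [(I * ξ) • H₁, (I * ξ) • H₂, -((I * ξ) • H₃), -((I * ξ) • H₄)] - 1‖
      ≤ 1 / 2 * S ^ 2 * ξ ^ 2 * Real.exp (ξ * S) + ξ * ‖(H₂ - H₄) - (H₃ - H₁)‖ := by
    rw [hlin]
    refine (norm_add_le _ _).trans (add_le_add (B12Plaquette343.elem343 hξ H₁ H₂ H₃ H₄) (le_of_eq ?_))
    rw [B12Membership314.norm_I_mul_smul hξ, show H₁ + H₂ - H₃ - H₄ = (H₂ - H₄) - (H₃ - H₁) by abel]
  rw [e]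
  exact (norm_add_le_of_le b1 b2).trans (le_of_eq (by ring))

/-- **THE PLAQUETTE VARIABLES OF `U′U` AND `U` DIFFER BY `O(η)` TIMES THE LETTERS**, general form (any complete normed ℂ-algebra, arbitrary
background units, `η ≥ 0`): `‖(U′U)(∂p) − U(∂p)‖ ≤ η‖(D¹_U A)(p)‖ + ½S(p)²η²e^{ηS(p)} + (e^{ηS(p)} − 1)‖U(∂p) − 1‖` — the word (3.1)
(`B9Eq369Product.plaqU_prodCfg_val`), its first order `η²(D^η_U A)(p)` (`far_sub_near_eq_curl`), `S(p)` = `B9Eq369Product.letterSize`.  Every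
term carries a factor `η·(letter)`: this is the «additional factor α₁» of p. 404. [folklore] [cite: Balaban1985BackgroundPropagators, p.404
after (3.69); (3.1) p.390, (3.4) p.391] -/
theorem norm_plaqU_prodCfg_sub_plaqU_le {η : ℝ} (hη : 0 ≤ η) (A : ι → S → 𝔸) (κ ν : ι) (y : S) :
    ‖(plaqU T (prodCfg U η A) κ ν y : 𝔸) - (plaqU T U κ ν y : 𝔸)‖
      ≤ η * ‖curl T U A κ ν y‖
        + 1 / 2 * letterSize T U A κ ν y ^ 2 * η ^ 2 * Real.exp (η * letterSize T U A κ ν y)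
        + (Real.exp (η * letterSize T U A κ ν y) - 1) * ‖(plaqU T U κ ν y : 𝔸) - 1‖ := by
  have e := norm_dressed_sub_le hη (A κ y) (R (U κ y) (A ν (T κ y))) (R (U ν y) (A κ (T ν y))) (A ν y) (plaqU T U κ ν y : 𝔸)
  have hc : (R (U κ y) (A ν (T κ y)) - A ν y) - (R (U ν y) (A κ (T ν y)) - A κ y) = curl T U A κ ν y :=
    far_sub_near_eq_curl T U A κ ν y
  have hS : ‖A κ y‖ + ‖R (U κ y) (A ν (T κ y))‖ + ‖R (U ν y) (A κ (T ν y))‖ + ‖A ν y‖ = letterSize T U A κ ν y := rfl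
  rw [hc, hS] at e
  rw [plaqU_prodCfg_val, R_smul, R_smul]
  exact e

/-- **UNDER (3.37)-TYPE BOUNDS AT `p`** (explicit letters): `‖A_κ(y)‖, ‖A_ν(y)‖ ≤ a`, `‖(D¹_{U,κ}A_ν)(y)‖, ‖(D¹_{U,ν}A_κ)(y)‖ ≤ g`,
`‖U(∂p) − 1‖ ≤ ε₀` give `‖(U′U)(∂p) − U(∂p)‖ ≤ 2ηg + ½(4a + 2g)²η²e^{η(4a+2g)} + (e^{η(4a+2g)} − 1)ε₀`. [folklore]
[cite: Balaban1985BackgroundPropagators, p.404 after (3.69); (3.37) p.396] -/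
theorem norm_plaqU_prodCfg_sub_plaqU_le_of_bounds {η a g ε₀ : ℝ} (hη : 0 ≤ η) {A : ι → S → 𝔸} {κ ν : ι} {y : S}
    (h₁ : ‖A κ y‖ ≤ a) (h₄ : ‖A ν y‖ ≤ a) (hDκ : ‖covD T U κ (A ν) y‖ ≤ g) (hDν : ‖covD T U ν (A κ) y‖ ≤ g)
    (hP : ‖(plaqU T U κ ν y : 𝔸) - 1‖ ≤ ε₀) :
    ‖(plaqU T (prodCfg U η A) κ ν y : 𝔸) - (plaqU T U κ ν y : 𝔸)‖
      ≤ 2 * η * g + 1 / 2 * (4 * a + 2 * g) ^ 2 * η ^ 2 * Real.exp (η * (4 * a + 2 * g))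
        + (Real.exp (η * (4 * a + 2 * g)) - 1) * ε₀ := by
  have hS : letterSize T U A κ ν y ≤ 4 * a + 2 * g := by
    unfold letterSize
    have e₂ := (norm_R_far_le T U A κ ν y).trans (add_le_add h₄ hDκ)
    have e₃ := (norm_R_far_le T U A ν κ y).trans (add_le_add h₁ hDν)
    linarith
  have hS0 := letterSize_nonneg T U A κ ν y
  have hcurl : ‖curl T U A κ ν y‖ ≤ 2 * g := by
    unfold curl
    exact (norm_sub_le _ _).trans (by linarith)
  have hexp : Real.exp (η * letterSize T U A κ ν y) ≤ Real.exp (η * (4 * a + 2 * g)) :=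
    Real.exp_le_exp.mpr (mul_le_mul_of_nonneg_left hS hη)
  have hE1 : 0 ≤ Real.exp (η * letterSize T U A κ ν y) - 1 := by
    linarith [Real.add_one_le_exp (η * letterSize T U A κ ν y), mul_nonneg hη hS0]
  have hε₀ : 0 ≤ ε₀ := (norm_nonneg _).trans hP
  refine (norm_plaqU_prodCfg_sub_plaqU_le T U hη A κ ν y).trans ?_
  have t1 : η * ‖curl T U A κ ν y‖ ≤ 2 * η * g := by nlinarith [norm_nonneg (curl T U A κ ν y)]
  have t2 : 1 / 2 * letterSize T U A κ ν y ^ 2 * η ^ 2 * Real.exp (η * letterSize T U A κ ν y)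
      ≤ 1 / 2 * (4 * a + 2 * g) ^ 2 * η ^ 2 * Real.exp (η * (4 * a + 2 * g)) := by
    gcongr
  have t3 : (Real.exp (η * letterSize T U A κ ν y) - 1) * ‖(plaqU T U κ ν y : 𝔸) - 1‖
      ≤ (Real.exp (η * (4 * a + 2 * g)) - 1) * ε₀ :=
    mul_le_mul (sub_le_sub_right hexp 1) hP (norm_nonneg _) (hE1.trans (sub_le_sub_right hexp 1))
  linarith

/-- THE CONSTANT OF THE PLAQUETTE DIFFERENCE at the printed letters: `k_P(α₁, C₀) = 2 + (18α₁ + 6C₀)e^{6α₁}` (`≤ 2 + 24e⁶·max(α₁, C₀)`;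
an absolute number once `α₁ ≤ 1` and `C₀ = O(1)(Mα₀ + α₁)` is fixed). [folklore] -/
def kP (α₁ C₀ : ℝ) : ℝ := 2 + (18 * α₁ + 6 * C₀) * Real.exp (6 * α₁)

omit [NormedAlgebra ℂ 𝔸] [CompleteSpace 𝔸] in
/-- `0 ≤ k_P` for `α₁, C₀ ≥ 0`. [folklore] -/
theorem kP_nonneg {α₁ C₀ : ℝ} (hα : 0 ≤ α₁) (hC : 0 ≤ C₀) : 0 ≤ kP α₁ C₀ := by
  unfold kP; positivity

omit [NormedAlgebra ℂ 𝔸] [CompleteSpace 𝔸] in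
/-- THE REAL-ARITHMETIC BUDGET OF THE DIFFERENCE: with `ξ ∈ [0, 1]`, `ηa ≤ α₁ξ`, `ηg ≤ α₁ξ²`, `ε₀ = C₀ξ²`:
`2ηg + ½(4a + 2g)²η²e^{η(4a+2g)} + (e^{η(4a+2g)} − 1)C₀ξ² ≤ α₁·k_P(α₁, C₀)·ξ²` (`u = η(4a + 2g) ≤ 6α₁ξ`, `e^{u} − 1 ≤ ue^{u}`). [folklore] -/
theorem budget_diff {η ξ α₁ C₀ a g : ℝ} (hη : 0 ≤ η) (hξ0 : 0 ≤ ξ) (hξ1 : ξ ≤ 1) (hα : 0 ≤ α₁) (hC : 0 ≤ C₀)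
    (ha0 : 0 ≤ a) (hg0 : 0 ≤ g) (ha : η * a ≤ α₁ * ξ) (hg : η * g ≤ α₁ * ξ ^ 2) :
    2 * η * g + 1 / 2 * (4 * a + 2 * g) ^ 2 * η ^ 2 * Real.exp (η * (4 * a + 2 * g))
        + (Real.exp (η * (4 * a + 2 * g)) - 1) * (C₀ * ξ ^ 2) ≤ α₁ * kP α₁ C₀ * ξ ^ 2 := by
  set u := η * (4 * a + 2 * g) with hu
  have hu0 : 0 ≤ u := by rw [hu]; positivity
  have hξ2 : ξ ^ 2 ≤ ξ := by nlinarith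
  have hu1 : u ≤ 6 * α₁ * ξ := by rw [hu]; nlinarith
  have h6 : 6 * α₁ * ξ ≤ 6 * α₁ := by nlinarith
  have hu2 : u ≤ 6 * α₁ := hu1.trans h6
  have hE : Real.exp u ≤ Real.exp (6 * α₁) := Real.exp_le_exp.mpr hu2
  have t1 : 2 * η * g ≤ 2 * α₁ * ξ ^ 2 := by nlinarith
  have t2 : 1 / 2 * (4 * a + 2 * g) ^ 2 * η ^ 2 * Real.exp u ≤ 18 * α₁ ^ 2 * ξ ^ 2 * Real.exp (6 * α₁) := by
    have e : (4 * a + 2 * g) ^ 2 * η ^ 2 = u ^ 2 := by rw [hu]; ring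
    have hu3 : u ^ 2 ≤ (6 * α₁ * ξ) ^ 2 := by nlinarith [mul_nonneg hu0 (by linarith : 0 ≤ 6 * α₁ * ξ - u)]
    calc 1 / 2 * (4 * a + 2 * g) ^ 2 * η ^ 2 * Real.exp u = 1 / 2 * u ^ 2 * Real.exp u := by rw [← e]; ring
      _ ≤ 1 / 2 * (6 * α₁ * ξ) ^ 2 * Real.exp (6 * α₁) :=
          mul_le_mul (mul_le_mul_of_nonneg_left hu3 (by norm_num)) hE (Real.exp_pos u).le (by positivity)
      _ = 18 * α₁ ^ 2 * ξ ^ 2 * Real.exp (6 * α₁) := by ring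
  have t3 : (Real.exp u - 1) * (C₀ * ξ ^ 2) ≤ 6 * α₁ * C₀ * Real.exp (6 * α₁) * ξ ^ 2 := by
    have h1 : Real.exp u - 1 ≤ u * Real.exp (6 * α₁) := exp_sub_one_le_mul_exp_of_le hu0 hu2
    have h2 : u * Real.exp (6 * α₁) ≤ 6 * α₁ * Real.exp (6 * α₁) := mul_le_mul_of_nonneg_right hu2 (Real.exp_pos _).le
    calc (Real.exp u - 1) * (C₀ * ξ ^ 2) ≤ (6 * α₁ * Real.exp (6 * α₁)) * (C₀ * ξ ^ 2) :=
          mul_le_mul_of_nonneg_right (h1.trans h2) (by positivity)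
      _ = 6 * α₁ * C₀ * Real.exp (6 * α₁) * ξ ^ 2 := by ring
  have ek : α₁ * kP α₁ C₀ * ξ ^ 2
      = 2 * α₁ * ξ ^ 2 + 18 * α₁ ^ 2 * ξ ^ 2 * Real.exp (6 * α₁) + 6 * α₁ * C₀ * Real.exp (6 * α₁) * ξ ^ 2 := by
    unfold kP; ring
  rw [ek]
  linarith

omit [NormedAlgebra ℂ 𝔸] [CompleteSpace 𝔸] in
/-- `ηa ≤ α₁L^{−j}` from `a ≤ α₁(L^jη)⁻¹` (`η > 0`). [folklore] -/
theorem eta_mul_le_xi {η L α₁ a : ℝ} {j : ℕ} (hη : 0 < η) (ha : a ≤ α₁ * (L ^ j * η)⁻¹) : η * a ≤ α₁ * (L ^ j)⁻¹ := by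
  calc η * a ≤ η * (α₁ * (L ^ j * η)⁻¹) := mul_le_mul_of_nonneg_left ha hη.le
    _ = α₁ * (η / (L ^ j * η)) := by ring
    _ = α₁ * (L ^ j)⁻¹ := by rw [eta_div_scale L η hη.ne' j]

omit [NormedAlgebra ℂ 𝔸] [CompleteSpace 𝔸] in
/-- `ηg ≤ α₁L^{−2j}` from `g ≤ η·α₁(L^jη)⁻²` (`η > 0`). [folklore] -/
theorem eta_mul_le_xi_sq {η L α₁ g : ℝ} {j : ℕ} (hη : 0 < η) (hg : g ≤ η * (α₁ * ((L ^ j * η)⁻¹) ^ 2)) :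
    η * g ≤ α₁ * ((L ^ j)⁻¹) ^ 2 := by
  calc η * g ≤ η * (η * (α₁ * ((L ^ j * η)⁻¹) ^ 2)) := mul_le_mul_of_nonneg_left hg hη.le
    _ = α₁ * (η / (L ^ j * η)) ^ 2 := by ring
    _ = α₁ * ((L ^ j)⁻¹) ^ 2 := by rw [eta_div_scale L η hη.ne' j]

omit [NormedAlgebra ℂ 𝔸] [CompleteSpace 𝔸] in
/-- `0 ≤ α₁` from `0 ≤ a ≤ α₁(L^jη)⁻¹` (`L ≥ 1`, `η > 0`). [folklore] -/
theorem alpha_nonneg_of_le {η L α₁ a : ℝ} {j : ℕ} (hη : 0 < η) (hL : 1 ≤ L) (ha0 : 0 ≤ a) (ha : a ≤ α₁ * (L ^ j * η)⁻¹) :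
    0 ≤ α₁ := by
  have hpos : 0 < (L ^ j * η)⁻¹ := inv_pos.mpr (mul_pos (pow_pos (by linarith) j) hη)
  nlinarith [ha0.trans ha]

/-- **THE PLAQUETTE DIFFERENCE AT THE PRINTED LETTERS** — «for the difference Δ′(U′U) − Δ′(U) we have a bound similar to (3.69), but with
additional factor α₁», plaquette level: (3.37) at `p` at scale `L^jη` (`‖A(b′)‖ ≤ a ≤ α₁(L^jη)⁻¹` on the two base bonds, `‖D¹_U A‖ ≤ g ≤
η·α₁(L^jη)⁻²` for the two covariant derivatives at `y`; `L ≥ 1`, `η > 0`) and the (3.35)-output `‖U(∂p) − 1‖ ≤ C₀L^{−2j}` give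
`‖(U′U)(∂p) − U(∂p)‖ ≤ α₁·k_P(α₁, C₀)·L^{−2j}` — ONE MORE FACTOR `α₁` than `B9Eq369Product.norm_plaqU_prodCfg_sub_one_le_printed`'s
`e^{6α₁}(C₀ + 2α₁ + 18α₁²)L^{−2j}` for `‖(U′U)(∂p) − 1‖`. [folklore] [cite: Balaban1985BackgroundPropagators, p.404 after (3.69); (3.35) p.396,
(3.37) p.396] -/
theorem norm_plaqU_prodCfg_sub_plaqU_le_printed {η L α₁ C₀ a g : ℝ} {j : ℕ} (hη : 0 < η) (hL : 1 ≤ L) {A : ι → S → 𝔸}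
    {κ ν : ι} {y : S} (h₁ : ‖A κ y‖ ≤ a) (h₄ : ‖A ν y‖ ≤ a) (ha : a ≤ α₁ * (L ^ j * η)⁻¹)
    (hDκ : ‖covD T U κ (A ν) y‖ ≤ g) (hDν : ‖covD T U ν (A κ) y‖ ≤ g) (hg : g ≤ η * (α₁ * ((L ^ j * η)⁻¹) ^ 2))
    (hP : ‖(plaqU T U κ ν y : 𝔸) - 1‖ ≤ C₀ * ((L ^ j)⁻¹) ^ 2) :
    ‖(plaqU T (prodCfg U η A) κ ν y : 𝔸) - (plaqU T U κ ν y : 𝔸)‖ ≤ α₁ * kP α₁ C₀ * ((L ^ j)⁻¹) ^ 2 := by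
  have ha0 : 0 ≤ a := (norm_nonneg _).trans h₁
  have hg0 : 0 ≤ g := (norm_nonneg _).trans hDκ
  have hLj : 1 ≤ L ^ j := one_le_pow₀ hL
  have hξ0 : 0 < (L ^ j)⁻¹ := inv_pos.mpr (by linarith)
  have hξ1 : (L ^ j)⁻¹ ≤ 1 := inv_le_one_of_one_le₀ hLj
  have hα0 : 0 ≤ α₁ := alpha_nonneg_of_le hη hL ha0 ha
  have hC0 : 0 ≤ C₀ := by nlinarith [(norm_nonneg _).trans hP, pow_pos hξ0 2]
  have ha' := eta_mul_le_xi hη ha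
  have hg' := eta_mul_le_xi_sq hη hg
  exact (norm_plaqU_prodCfg_sub_plaqU_le_of_bounds T U hη.le h₁ h₄ hDκ hDν hP).trans
    (budget_diff hη.le hξ0.le hξ1 hα0 hC0 ha0 hg0 ha' hg')

/-- THE CONSTANT OF THE `Δ′`-DIFFERENCE at the printed letters (group-valued background): with `E = e^{α₁}`, `Θ = ½(1 + E⁴)·k_P(α₁, C₀)`,
`k_Δ(α₁, C₀) = E⁴·(14Θ + 30(C₀ + α₁Θ))` — the `14ρ⁴·θ` (weights moved by the plaquette difference) and `15ρ²σ·δ` (transports moved by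
`σ = 2α₁E²L^{−j}`) of §2 at `ρ = E`. [folklore] -/
def kΔ (α₁ C₀ : ℝ) : ℝ :=
  Real.exp α₁ ^ 4 * (14 * ((1 + Real.exp α₁ ^ 4) / 2 * kP α₁ C₀) + 30 * (C₀ + α₁ * ((1 + Real.exp α₁ ^ 4) / 2 * kP α₁ C₀)))

variable [Fintype ι] [LinearOrder ι]

omit [NormedAlgebra ℂ 𝔸] [CompleteSpace 𝔸] in
/-- Either some positively oriented plaquette passes through `b = ⟨x, x+e_μ⟩` (there is a direction `ν ≠ μ`), or `d − 1 = 0`. [folklore] -/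
theorem through_or_card_le (μ : ι) (x : S) :
    (∃ κ ν y, Through T μ x κ ν y) ∨ ((Fintype.card ι - 1 : ℕ) : ℝ) = 0 := by
  by_cases hc : 1 < Fintype.card ι
  · obtain ⟨ν, hν⟩ := Fintype.exists_ne_of_one_lt_card hc μ
    rcases lt_or_gt_of_ne hν with h | h
    · exact Or.inl ⟨ν, μ, x, h, Or.inl ⟨rfl, Or.inl rfl⟩⟩
    · exact Or.inl ⟨μ, ν, x, h, Or.inr ⟨rfl, Or.inl rfl⟩⟩
  · right
    rw [Nat.sub_eq_zero_of_le (not_lt.mp hc), Nat.cast_zero]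

/-- **p. 404 — «FOR THE DIFFERENCE Δ′(U′U) − Δ′(U) WE HAVE A BOUND SIMILAR TO (3.69), BUT WITH ADDITIONAL FACTOR α₁».**  Group-valued
background (`‖U(b′)^{±1}‖ ≤ 1`), fluctuation field `U′ = e^{iηA}` with (3.37)-type bounds at scale `L^jη` on all bonds (`‖A‖ ≤ a ≤
α₁(L^jη)⁻¹`, `‖D¹_U A‖ ≤ g ≤ η·α₁(L^jη)⁻²`; `L ≥ 1`, `η > 0`), the (3.35)-output `‖U(∂p) − 1‖ ≤ C₀L^{−2j}` and `‖A′(b′)‖ ≤ a′` on the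
plaquettes through `b = ⟨x, x+e_μ⟩`: `‖(Δ′(U′U)A′)(b) − (Δ′(U)A′)(b)‖ ≤ (d − 1)·α₁·k_Δ(α₁, C₀)·(L^jη)⁻²·a′` — versus (3.69)'s
`O(1)(Mα₀ + α₁)(L^jη)⁻²|A′|` for each operator separately (`B9Eq369Small.eq369`, `B9Eq369Product.eq369_prodCfg_group`): the overall factor
`α₁` is explicit; `k_Δ` is an absolute number once `α₁ ≤ 1` and `C₀ = O(1)(Mα₀ + α₁)` are fixed.  READING (header, (b)): `k_Δ(0, 0) = 28 ≠ 0` —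
the factor `α₁` comes IN PLACE OF `(Mα₀ + α₁)` (the weight differences are first order in `η(D¹_U A)(p) ≤ 2α₁ξ²`), `C₀` re-enters times `α₁`;
the literal product `O(1)(Mα₀ + α₁)α₁` is not claimed.  «It is not essential in the sequal.» [sic] — recorded, not used downstream. [folklore] [cite: Balaban1985BackgroundPropagators, p.404 after (3.69); (3.10) p.392, (3.35) p.396, (3.37) p.396] -/
theorem eq369_diff {η L α₁ C₀ a g a' : ℝ} {j : ℕ} (hη : 0 < η) (hL : 1 ≤ L)
    (hU : ∀ κ z, ‖(U κ z : 𝔸)‖ ≤ 1) (hU' : ∀ κ z, ‖(((U κ z)⁻¹ : 𝔸ˣ) : 𝔸)‖ ≤ 1)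
    (A A' : ι → S → 𝔸) (hA : ∀ κ z, ‖A κ z‖ ≤ a) (ha : a ≤ α₁ * (L ^ j * η)⁻¹)
    (hdA : ∀ κ τ z, ‖covD T U κ (A τ) z‖ ≤ g) (hg : g ≤ η * (α₁ * ((L ^ j * η)⁻¹) ^ 2)) (μ : ι) (x : S)
    (hA' : ∀ κ ν y, Through T μ x κ ν y → ‖A' κ y‖ ≤ a' ∧ ‖A' ν (T κ y)‖ ≤ a' ∧ ‖A' κ (T ν y)‖ ≤ a' ∧ ‖A' ν y‖ ≤ a')
    (h35 : ∀ κ ν y, Through T μ x κ ν y → ‖(plaqU T U κ ν y : 𝔸) - 1‖ ≤ C₀ * ((L ^ j)⁻¹) ^ 2) :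
    ‖deltaPrimeOp T (prodCfg U η A) η A' μ x - deltaPrimeOp T U η A' μ x‖
      ≤ ((Fintype.card ι - 1 : ℕ) : ℝ) * (α₁ * kΔ α₁ C₀ * ((L ^ j * η) ^ 2)⁻¹ * a') := by
  -- the scales
  have ha0 : 0 ≤ a := (norm_nonneg _).trans (hA μ x)
  have hLj : 1 ≤ L ^ j := one_le_pow₀ hL
  set ξ := (L ^ j)⁻¹ with hξ
  have hξ0 : 0 < ξ := inv_pos.mpr (by linarith)
  have hξ1 : ξ ≤ 1 := inv_le_one_of_one_le₀ hLj
  have hα0 : 0 ≤ α₁ := alpha_nonneg_of_le hη hL ha0 ha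
  have haξ : η * a ≤ α₁ * ξ := eta_mul_le_xi hη ha
  set E := Real.exp α₁ with hEdef
  have hE1 : 1 ≤ E := Real.one_le_exp hα0
  have hE2 : Real.exp (2 * α₁) = E ^ 2 := by rw [show 2 * α₁ = α₁ + α₁ by ring, Real.exp_add, hEdef]; ring
  -- transports: `ρ = E` for both configurations, `σ = 2α₁ξE²`
  have hU1 : ∀ κ z, ‖(U κ z : 𝔸)‖ ≤ 1 ∧ ‖(((U κ z)⁻¹ : 𝔸ˣ) : 𝔸)‖ ≤ 1 := fun κ z => ⟨hU κ z, hU' κ z⟩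
  have hUρ : ∀ κ z, ‖(U κ z : 𝔸)‖ ≤ E ∧ ‖(((U κ z)⁻¹ : 𝔸ˣ) : 𝔸)‖ ≤ E := fun κ z => ⟨(hU κ z).trans hE1, (hU' κ z).trans hE1⟩
  have hs : ∀ κ z, η * ‖A κ z‖ ≤ α₁ * ξ := fun κ z => (mul_le_mul_of_nonneg_left (hA κ z) hη.le).trans haξ
  have hs1 : ∀ κ z, η * ‖A κ z‖ ≤ α₁ := fun κ z => (hs κ z).trans (by nlinarith)
  have hVρ : ∀ κ z, ‖(prodCfg U η A κ z : 𝔸)‖ ≤ E ∧ ‖(((prodCfg U η A κ z)⁻¹ : 𝔸ˣ) : 𝔸)‖ ≤ E := by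
    intro κ z; simpa only [mul_one] using norm_prodCfg_le U hη.le hs1 hU1 κ z
  set σ := 2 * (α₁ * ξ) * E ^ 2 with hσdef
  have hσ0 : 0 ≤ σ := by rw [hσdef]; positivity
  have hσle : 1 ^ 2 * (Real.exp (2 * (α₁ * ξ)) - 1) ≤ σ := by
    rw [one_pow, one_mul, hσdef, ← hE2]
    exact exp_sub_one_le_mul_exp_of_le (by positivity) (by nlinarith)
  have hσ : ∀ κ z X, ‖R (prodCfg U η A κ z) X - R (U κ z) X‖ ≤ σ * ‖X‖ := fun κ z X =>
    ((norm_R_prodCfg_sub_le U hη.le hs hU1 κ z X).1).trans (mul_le_mul_of_nonneg_right hσle (norm_nonneg _))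
  have hσ' : ∀ κ z X, ‖R (prodCfg U η A κ z)⁻¹ X - R (U κ z)⁻¹ X‖ ≤ σ * ‖X‖ := fun κ z X =>
    ((norm_R_prodCfg_sub_le U hη.le hs hU1 κ z X).2).trans (mul_le_mul_of_nonneg_right hσle (norm_nonneg _))
  -- weights: `θ = (η²)⁻¹ξ²·α₁Θ`, `δ = (η²)⁻¹ξ²·(C₀ + α₁Θ)`, `Θ = ½(1 + E⁴)k_P`
  set Θ := (1 + E ^ 4) / 2 * kP α₁ C₀ with hΘdef
  set θ := (η ^ 2)⁻¹ * ξ ^ 2 * (α₁ * Θ) with hθdef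
  set δ := (η ^ 2)⁻¹ * ξ ^ 2 * (C₀ + α₁ * Θ) with hδdef
  have hplaq : ∀ κ ν y, Through T μ x κ ν y →
      ‖(plaqU T (prodCfg U η A) κ ν y : 𝔸) - (plaqU T U κ ν y : 𝔸)‖ ≤ α₁ * kP α₁ C₀ * ξ ^ 2 := fun κ ν y h =>
    norm_plaqU_prodCfg_sub_plaqU_le_printed T U hη hL (hA κ y) (hA ν y) ha (hdA κ ν y) (hdA ν κ y) hg (h35 κ ν y h)
  have hzθ : ∀ κ ν y, Through T μ x κ ν y → ‖zP T (prodCfg U η A) η κ ν y - zP T U η κ ν y‖ ≤ θ := by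
    intro κ ν y h
    refine (norm_zP_sub_zP_le T U (prodCfg U η A) (norm_plaqU_inv_le T (prodCfg U η A) hVρ κ ν y)
      (norm_plaqU_inv_le_one T U hU1 κ ν y) (hplaq κ ν y h)).trans (le_of_eq ?_)
    rw [hθdef, hΘdef]; ring
  have hyθ : ∀ κ ν y, Through T μ x κ ν y → ‖yP T (prodCfg U η A) η κ ν y - yP T U η κ ν y‖ ≤ θ := by
    intro κ ν y h
    refine (norm_yP_sub_yP_le T U (prodCfg U η A) (norm_plaqU_inv_le T (prodCfg U η A) hVρ κ ν y)
      (norm_plaqU_inv_le_one T U hU1 κ ν y) (hplaq κ ν y h)).trans (le_of_eq ?_)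
    rw [hθdef, hΘdef]; ring
  have hC0θ : ∀ κ ν y, Through T μ x κ ν y → 0 ≤ C₀ ∧ 0 ≤ θ := by
    intro κ ν y h
    have hC0 : 0 ≤ C₀ := by nlinarith [(norm_nonneg _).trans (h35 κ ν y h), pow_pos hξ0 2]
    refine ⟨hC0, ?_⟩
    rw [hθdef, hΘdef]
    have := kP_nonneg hα0 hC0
    positivity
  have hδU : ∀ κ ν y, Through T μ x κ ν y → ‖zP T U η κ ν y‖ ≤ δ ∧ ‖yP T U η κ ν y‖ ≤ δ := by
    intro κ ν y h
    obtain ⟨hC0, hθ0⟩ := hC0θ κ ν y h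
    have e : (η ^ 2)⁻¹ * (C₀ * ξ ^ 2) ≤ δ := by
      rw [hδdef]
      have : (η ^ 2)⁻¹ * ξ ^ 2 * (C₀ + α₁ * Θ) = (η ^ 2)⁻¹ * (C₀ * ξ ^ 2) + θ := by rw [hθdef]; ring
      rw [this]; linarith
    exact ⟨(norm_zP_le_of_plaq_one T U hU1 (h35 κ ν y h)).trans e, (norm_yP_le_of_plaq_one T U hU1 (h35 κ ν y h)).trans e⟩
  have hθδ : (η ^ 2)⁻¹ * (C₀ * ξ ^ 2) + θ = δ := by rw [hδdef, hθdef]; ring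
  have hz : ∀ κ ν y, Through T μ x κ ν y → ‖zP T U η κ ν y‖ ≤ δ ∧ ‖zP T (prodCfg U η A) η κ ν y‖ ≤ δ
      ∧ ‖zP T (prodCfg U η A) η κ ν y - zP T U η κ ν y‖ ≤ θ := by
    intro κ ν y h
    refine ⟨(hδU κ ν y h).1, ?_, hzθ κ ν y h⟩
    have e : zP T (prodCfg U η A) η κ ν y = zP T U η κ ν y + (zP T (prodCfg U η A) η κ ν y - zP T U η κ ν y) := by abel
    rw [e, ← hθδ]
    exact norm_add_le_of_le (norm_zP_le_of_plaq_one T U hU1 (h35 κ ν y h)) (hzθ κ ν y h)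
  have hy : ∀ κ ν y, Through T μ x κ ν y → ‖yP T U η κ ν y‖ ≤ δ ∧ ‖yP T (prodCfg U η A) η κ ν y‖ ≤ δ
      ∧ ‖yP T (prodCfg U η A) η κ ν y - yP T U η κ ν y‖ ≤ θ := by
    intro κ ν y h
    refine ⟨(hδU κ ν y h).2, ?_, hyθ κ ν y h⟩
    have e : yP T (prodCfg U η A) η κ ν y = yP T U η κ ν y + (yP T (prodCfg U η A) η κ ν y - yP T U η κ ν y) := by abel
    rw [e, ← hθδ]
    exact norm_add_le_of_le (norm_yP_le_of_plaq_one T U hU1 (h35 κ ν y h)) (hyθ κ ν y h)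
  -- §2 with `V = U′U`
  have main := norm_deltaPrimeOp_sub_le_local T U (prodCfg U η A) hE1 hUρ hVρ hσ0 hσ hσ' μ x hA' hz hy
  refine main.trans ?_
  -- the coefficient: `14E⁴θ + 15E²σδ ≤ α₁k_Δ(η²)⁻¹ξ²` (one `ξ ≤ 1` dropped in the `σδ` term); `d − 1 = 0` if nothing passes through `b`
  rcases through_or_card_le T μ x with ⟨κ, ν, y, h⟩ | hd
  · have ha' : 0 ≤ a' := (norm_nonneg _).trans (hA' κ ν y h).1
    obtain ⟨hC0, hθ0⟩ := hC0θ κ ν y h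
    have hE0 : 0 < E := lt_of_lt_of_le one_pos hE1
    have hΘ0 : 0 ≤ Θ := by rw [hΘdef]; have := kP_nonneg hα0 hC0; positivity
    have hcoef : 14 * E ^ 4 * θ + 15 * E ^ 2 * σ * δ ≤ α₁ * kΔ α₁ C₀ * ((η ^ 2)⁻¹ * ξ ^ 2) := by
      have e : α₁ * kΔ α₁ C₀ * ((η ^ 2)⁻¹ * ξ ^ 2) - (14 * E ^ 4 * θ + 15 * E ^ 2 * σ * δ)
          = 30 * α₁ * E ^ 4 * ((η ^ 2)⁻¹ * ξ ^ 2) * (C₀ + α₁ * Θ) * (1 - ξ) := by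
        simp only [hθdef, hδdef, hσdef, hΘdef, hEdef, kΔ]; ring
      have hB : 0 ≤ 30 * α₁ * E ^ 4 * ((η ^ 2)⁻¹ * ξ ^ 2) * (C₀ + α₁ * Θ) := by positivity
      have hnn := mul_nonneg hB (by linarith : 0 ≤ 1 - ξ)
      linarith
    calc (14 * E ^ 4 * θ + 15 * E ^ 2 * σ * δ) * a' * ((Fintype.card ι - 1 : ℕ) : ℝ)
        ≤ (α₁ * kΔ α₁ C₀ * ((η ^ 2)⁻¹ * ξ ^ 2)) * a' * ((Fintype.card ι - 1 : ℕ) : ℝ) := by gcongr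
      _ = ((Fintype.card ι - 1 : ℕ) : ℝ) * (α₁ * kΔ α₁ C₀ * ((L ^ j * η) ^ 2)⁻¹ * a') := by
          rw [hξ, xi_sq_div_eta_sq]; ring
  · rw [hd, mul_zero, zero_mul]

end ProdCfg


/-! ## §4  p. 407: `V₃(A) = V₁(A) − (Δ′(U′U) − Δ′(U)) + V₂(A)` is local and satisfies the bound (3.73) -/

section CfgLocality

variable {𝔸 : Type*} [Ring 𝔸] [Algebra ℂ 𝔸] {S : Type*} {ι : Type*}
variable (T : ι → Equiv.Perm S)

omit [Algebra ℂ 𝔸] in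
/-- The plaquette variable `U(∂p)` depends on the configuration only through the four bonds `b′ ⊂ ∂p`. [folklore]
[cite: Balaban1985BackgroundPropagators, (3.1) p.390] -/
theorem plaqU_congr_cfg {V W : ι → S → 𝔸ˣ} {κ ν : ι} {y : S} (h₁ : V κ y = W κ y) (h₂ : V ν (T κ y) = W ν (T κ y))
    (h₃ : V κ (T ν y) = W κ (T ν y)) (h₄ : V ν y = W ν y) : plaqU T V κ ν y = plaqU T W κ ν y := by
  simp only [plaqU, h₁, h₂, h₃, h₄]

/-- The letter functions `F^J(p)`, `G_k(p)` of (3.10) depend on the configuration only through the four bonds `b′ ⊂ ∂p` (the weights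
`z(p)`, `y(p)` through `U(∂p)`, the curl and the partner sums through the transports `U_κ(y)`, `U_ν(y)`). [folklore]
[cite: Balaban1985BackgroundPropagators, (3.10) p.392] -/
theorem jordanF_commG_congr_cfg (η : ℝ) (A : ι → S → 𝔸) {V W : ι → S → 𝔸ˣ} {κ ν : ι} {y : S} (h₁ : V κ y = W κ y)
    (h₂ : V ν (T κ y) = W ν (T κ y)) (h₃ : V κ (T ν y) = W κ (T ν y)) (h₄ : V ν y = W ν y) :
    jordanF T V η A κ ν y = jordanF T W η A κ ν y ∧ commG₁ T V η A κ ν y = commG₁ T W η A κ ν y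
      ∧ commG₂ T V η A κ ν y = commG₂ T W η A κ ν y ∧ commG₃ T V η A κ ν y = commG₃ T W η A κ ν y
      ∧ commG₄ T V η A κ ν y = commG₄ T W η A κ ν y := by
  have hP := plaqU_congr_cfg T h₁ h₂ h₃ h₄
  simp only [jordanF, commG₁, commG₂, commG₃, commG₄, zP, yP, curl, covD, sgnSum₁, sgnSum₂, sgnSum₃, sgnSum₄, hP, h₁, h₄,
    and_self]

variable [Fintype ι] [LinearOrder ι]

omit [Algebra ℂ 𝔸] in
/-- The letter divergence at `b = ⟨x, x+e_μ⟩` sees the configuration only through the transports `U_ν(x−e_ν)`, `ν ≠ μ` — bonds of the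
plaquettes through `b`. [folklore] [cite: Balaban1985BackgroundPropagators, (3.9) p.392] -/
theorem divL_congr_cfg {V W : ι → S → 𝔸ˣ} {G₁ G₂ G₃ G₄ : ι → ι → S → 𝔸} (μ : ι) (x : S)
    (hVW : ∀ ν, ν ≠ μ → V ν ((T ν).symm x) = W ν ((T ν).symm x)) :
    divL T V G₁ G₂ G₃ G₄ μ x = divL T W G₁ G₂ G₃ G₄ μ x := by
  unfold divL
  congr 1
  · refine Finset.sum_congr rfl fun ν _ => ?_
    split_ifs with h
    · rw [hVW ν h.ne]
    · rfl
  · refine Finset.sum_congr rfl fun ν _ => ?_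
    split_ifs with h
    · rw [hVW ν h.ne']
    · rfl

/-- **LOCALITY OF `Δ′` IN THE CONFIGURATION**: if two configurations agree on the boundary bonds of every plaquette through `b`, then
their operators `Δ′` of (3.10) agree at `b` on every bond field (companion of `B9Eq369Small.deltaPrimeOp_congr_local`, locality in the
field). [folklore] [cite: Balaban1985BackgroundPropagators, (3.10) p.392, (3.69) p.404] -/
theorem deltaPrimeOp_congr_cfg (η : ℝ) (A : ι → S → 𝔸) {V W : ι → S → 𝔸ˣ} (μ : ι) (x : S)
    (hVW : ∀ κ ν y, Through T μ x κ ν y →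
      V κ y = W κ y ∧ V ν (T κ y) = W ν (T κ y) ∧ V κ (T ν y) = W κ (T ν y) ∧ V ν y = W ν y) :
    deltaPrimeOp T V η A μ x = deltaPrimeOp T W η A μ x := by
  have hJ : ∀ κ ν y, Through T μ x κ ν y → jordanF T V η A κ ν y = jordanF T W η A κ ν y ∧
      jordanF T V η A κ ν y = jordanF T W η A κ ν y ∧ jordanF T V η A κ ν y = jordanF T W η A κ ν y ∧
      jordanF T V η A κ ν y = jordanF T W η A κ ν y := by
    intro κ ν y h
    obtain ⟨h₁, h₂, h₃, h₄⟩ := hVW κ ν y h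
    have e := (jordanF_commG_congr_cfg T η A h₁ h₂ h₃ h₄).1
    exact ⟨e, e, e, e⟩
  have hG : ∀ κ ν y, Through T μ x κ ν y → commG₁ T V η A κ ν y = commG₁ T W η A κ ν y ∧
      commG₂ T V η A κ ν y = commG₂ T W η A κ ν y ∧ commG₃ T V η A κ ν y = commG₃ T W η A κ ν y ∧
      commG₄ T V η A κ ν y = commG₄ T W η A κ ν y := by
    intro κ ν y h
    obtain ⟨h₁, h₂, h₃, h₄⟩ := hVW κ ν y h
    exact (jordanF_commG_congr_cfg T η A h₁ h₂ h₃ h₄).2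
  have hT : ∀ ν, ν ≠ μ → V ν ((T ν).symm x) = W ν ((T ν).symm x) := by
    intro ν hν
    rcases lt_or_gt_of_ne hν with h | h
    · exact (hVW ν μ ((T ν).symm x) ⟨h, Or.inl ⟨rfl, Or.inr rfl⟩⟩).1
    · exact (hVW μ ν ((T ν).symm x) ⟨h, Or.inr ⟨rfl, Or.inr rfl⟩⟩).2.2.2
  unfold deltaPrimeOp
  rw [← divL_self, ← divL_self, divL_congr_local T V μ x hJ, divL_congr_local T V μ x hG, divL_congr_cfg T μ x hT,
    divL_congr_cfg T μ x hT]

omit [Fintype ι] in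
/-- Agreement on the bonds of `st(b)` gives agreement on the four letters of every plaquette through `b` (the converse reading of
`B9Eq372Locality.agree_on_stBonds_of_through`). [folklore] [cite: Balaban1985BackgroundPropagators, p.404 after (3.69)] -/
theorem agree_through_of_stBonds {β : Type*} {A B : ι → S → β} {μ : ι} {x : S}
    (h : ∀ κ z, (κ, z) ∈ stBonds T μ x → A κ z = B κ z) :
    ∀ κ ν y, Through T μ x κ ν y → A κ y = B κ y ∧ A ν (T κ y) = B ν (T κ y) ∧ A κ (T ν y) = B κ (T ν y) ∧ A ν y = B ν y := by
  intro κ ν y hth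
  have m : ∀ q, q ∈ pBonds T κ ν y → q ∈ stBonds T μ x := fun q hq => mem_stBonds_iff.mpr ⟨κ, ν, y, hth, hq⟩
  refine ⟨h _ _ (m _ ?_), h _ _ (m _ ?_), h _ _ (m _ ?_), h _ _ (m _ ?_)⟩ <;> simp [pBonds]

end CfgLocality

section V3

variable {𝔸 : Type*} [NormedRing 𝔸] [NormedAlgebra ℂ 𝔸] [CompleteSpace 𝔸] {S : Type*} {ι : Type*}
variable (T : ι → Equiv.Perm S) (U : ι → S → 𝔸ˣ)

/-- The bond variables of `U′U` at `b′` depend on `A` only through `A(b′)`. [folklore] -/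
theorem prodCfg_congr_pt (η : ℝ) {A B : ι → S → 𝔸} {κ : ι} {z : S} (h : A κ z = B κ z) :
    prodCfg U η A κ z = prodCfg U η B κ z := by
  show fluct η A κ z * U κ z = fluct η B κ z * U κ z
  simp only [fluct, h]

variable [Fintype ι] [LinearOrder ι]

/-- **`(V₃(A)A′)(b)` AT THE PRINTED SCALE**: `V₃(A) = V₁(A) − (Δ′(U′U) − Δ′(U)) + V₂(A)` (`B9Eq386Neumann.vThree` BY NAME — the sign forced by
the third equality of (3.82)), with `V₁(A)A′ = η⁻²·V₁op`, `V₂(A)A′ = η⁻²·V₂op` (the lineage's `V₁op`, `V₂op` are `η²` times the print's,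
`B9Eq371Composition`/`B9Eq375Composition`) and `Δ′` at the printed scale (`B9Eq310Hermitian.deltaPrimeOp`, weights `η⁻²(Re U(∂p) − 1)`,
`η⁻² Im U(∂p)`). [folklore] [cite: Balaban1985BackgroundPropagators, (3.82) p.407, (3.71) p.405, (3.75) p.405] -/
def V₃val (η : ℝ) (A A' : ι → S → 𝔸) (μ : ι) (x : S) : 𝔸 :=
  vThree ((((η : ℂ)⁻¹) ^ 2) • V₁op T U η A A' μ x) ((((η : ℂ)⁻¹) ^ 2) • V₂op T U η A A' μ x)
    (deltaPrimeOp T U η A' μ x) (deltaPrimeOp T (prodCfg U η A) η A' μ x)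

/-- `(V₃(A)A′)(b) = η⁻²(V₁op)(b) − ((Δ′(U′U)A′)(b) − (Δ′(U)A′)(b)) + η⁻²(V₂op)(b)`, definitionally. [folklore]
[cite: Balaban1985BackgroundPropagators, (3.82) p.407] -/
theorem V₃val_eq (η : ℝ) (A A' : ι → S → 𝔸) (μ : ι) (x : S) :
    V₃val T U η A A' μ x
      = (((η : ℂ)⁻¹) ^ 2) • V₁op T U η A A' μ x - (deltaPrimeOp T (prodCfg U η A) η A' μ x - deltaPrimeOp T U η A' μ x)
        + (((η : ℂ)⁻¹) ^ 2) • V₂op T U η A A' μ x := rfl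

/-- `‖(V₃(A)A′)(b)‖ ≤ η⁻²‖V₁op(b)‖ + ‖(Δ′(U′U)A′)(b) − (Δ′(U)A′)(b)‖ + η⁻²‖V₂op(b)‖`. [folklore] -/
theorem norm_V₃val_le (η : ℝ) (A A' : ι → S → 𝔸) (μ : ι) (x : S) :
    ‖V₃val T U η A A' μ x‖
      ≤ (η ^ 2)⁻¹ * ‖V₁op T U η A A' μ x‖ + ‖deltaPrimeOp T (prodCfg U η A) η A' μ x - deltaPrimeOp T U η A' μ x‖
        + (η ^ 2)⁻¹ * ‖V₂op T U η A A' μ x‖ := by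
  rw [V₃val_eq]
  refine norm_add_le_of_le (norm_sub_le_of_le (le_of_eq ?_) le_rfl) (le_of_eq ?_) <;> rw [norm_smul, norm_eta_inv_sq]

/-- **p. 407 — «THE OPERATOR V₃(A) IS A LOCAL DIFFERENTIAL OPERATOR OF THE FIRST ORDER SATISFYING THE BOUND (3.73)»**, the bound:
group-valued background (`‖U(b′)^{±1}‖ ≤ 1`), `U′ = e^{iηA}` with (3.37)-type bounds at scale `L^jη` (`‖A‖ ≤ a ≤ α₁(L^jη)⁻¹`,
`‖D¹_U A‖ ≤ g ≤ η·α₁(L^jη)⁻²`; `L ≥ 1`, `η > 0`), the argument `‖A′‖ ≤ a′`, `‖D¹_U A′‖ ≤ g′` (`g′ = η|∇^η_U A′|`) and the (3.35)-output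
`‖U(∂p) − 1‖ ≤ C₀L^{−2j}` on the plaquettes through `b`:
`‖(V₃(A)A′)(b)‖ ≤ α₁·[20d·(L^jη)⁻¹·|∇^η_U A′| + (d·(10 + 12α₁e^{2α₁}(3 + 2α₁ + α₁²e^{2α₁})) + (d − 1)·k_Δ(α₁, C₀))·(L^jη)⁻²·a′]` — the
print's «|(V(A)A′)(b)| ≤ O(1)α₁((L^jη)⁻¹|∇A′| + (L^jη)⁻²|A′|), b ∈ Ω_j (3.73) … The constant O(1) is an absolute constant depending on d only»
for `V = V₃`, with every `O(1)` explicit (absolute once `α₁ ≤ 1` and `C₀ = O(1)(Mα₀ + α₁)` are fixed): (3.73) for `V₁`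
(`B9Eq371Composition.norm_V₁op_le_printed`), for `V₂` (`B9Eq375Composition.norm_V₂op_le_printed`) and §3 for the difference, added.
[folklore] [cite: Balaban1985BackgroundPropagators, p.407 after (3.82); (3.73) p.405, p.404 after (3.69)] -/
theorem eq373_V₃ {η L α₁ C₀ a a' g g' : ℝ} {j : ℕ} (hη : 0 < η) (hL : 1 ≤ L)
    (hU : ∀ κ z, ‖(U κ z : 𝔸)‖ ≤ 1) (hU' : ∀ κ z, ‖(((U κ z)⁻¹ : 𝔸ˣ) : 𝔸)‖ ≤ 1)
    (A A' : ι → S → 𝔸) (hA : ∀ κ z, ‖A κ z‖ ≤ a) (ha : a ≤ α₁ * (L ^ j * η)⁻¹) (hA' : ∀ κ z, ‖A' κ z‖ ≤ a')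
    (hdA : ∀ κ τ z, ‖covD T U κ (A τ) z‖ ≤ g) (hg : g ≤ η * (α₁ * ((L ^ j * η)⁻¹) ^ 2))
    (hdA' : ∀ κ τ z, ‖covD T U κ (A' τ) z‖ ≤ g') (μ : ι) (x : S)
    (h35 : ∀ κ ν y, Through T μ x κ ν y → ‖(plaqU T U κ ν y : 𝔸) - 1‖ ≤ C₀ * ((L ^ j)⁻¹) ^ 2) :
    ‖V₃val T U η A A' μ x‖
      ≤ α₁ * (Fintype.card ι * (20 * (L ^ j * η)⁻¹ * (η⁻¹ * g'))
          + (Fintype.card ι * (10 + 12 * α₁ * Real.exp (2 * α₁) * (3 + 2 * α₁ + α₁ ^ 2 * Real.exp (2 * α₁)))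
              + ((Fintype.card ι - 1 : ℕ) : ℝ) * kΔ α₁ C₀) * ((L ^ j * η) ^ 2)⁻¹ * a') := by
  have h1 := norm_V₁op_le_printed T U hη hL hU hU' A A' hA ha hA' hdA hg hdA' μ x
  have h2 := norm_V₂op_le_printed T U hη hL hU hU' A A' hA ha hA' hdA hg hdA' μ x
  have hD := eq369_diff T U hη hL hU hU' A A' hA ha hdA hg μ x
    (fun κ ν y _ => ⟨hA' κ y, hA' ν (T κ y), hA' κ (T ν y), hA' ν y⟩) h35
  have hη2 : 0 ≤ (η ^ 2)⁻¹ := inv_nonneg.mpr (sq_nonneg η)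
  have t1 := mul_le_mul_of_nonneg_left h1 hη2
  have t2 := mul_le_mul_of_nonneg_left h2 hη2
  refine (norm_V₃val_le T U η A A' μ x).trans ((add_le_add (add_le_add t1 hD) t2).trans (le_of_eq ?_))
  have hη0 : η ≠ 0 := hη.ne'
  have hLj : L ^ j ≠ 0 := (pow_pos (by linarith) j).ne'
  field_simp
  ring

/-- **«LOCAL»**: `(V₃(A)A′)(b)` depends on `A` and on `A′` only through their values on the bonds of `st(b)` (for `V₁` and for both `Δ′`:
`B9Eq372Locality.V₁op_congr_st`, `B9Eq369Small.deltaPrimeOp_congr_local`, `deltaPrimeOp_congr_cfg` with `prodCfg_congr_pt`) and on the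
dependence set `locBonds₂` of `V₂` (`B9Eq375Locality.V₂op_congr_loc`: `st(b)`-bonds plus the collinear bonds `b ± e_μ`, see the
DIVERGENCE note of that file) — the typed content of «local differential operator» for `V₃`. [folklore]
[cite: Balaban1985BackgroundPropagators, p.407 after (3.82); p.404 after (3.69), (3.75) p.405] -/
theorem V₃val_congr (η : ℝ) {A B A' B' : ι → S → 𝔸} {μ : ι} {x : S}
    (hA : ∀ κ z, (κ, z) ∈ stBonds T μ x ∪ locBonds₂ T μ x → A κ z = B κ z)
    (hA' : ∀ κ z, (κ, z) ∈ stBonds T μ x ∪ locBonds₂ T μ x → A' κ z = B' κ z) :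
    V₃val T U η A A' μ x = V₃val T U η B B' μ x := by
  have hAs : ∀ κ z, (κ, z) ∈ stBonds T μ x → A κ z = B κ z := fun κ z h => hA κ z (Set.mem_union_left _ h)
  have hA's : ∀ κ z, (κ, z) ∈ stBonds T μ x → A' κ z = B' κ z := fun κ z h => hA' κ z (Set.mem_union_left _ h)
  have hAl : ∀ κ z, (κ, z) ∈ locBonds₂ T μ x → A κ z = B κ z := fun κ z h => hA κ z (Set.mem_union_right _ h)
  have hA'l : ∀ κ z, (κ, z) ∈ locBonds₂ T μ x → A' κ z = B' κ z := fun κ z h => hA' κ z (Set.mem_union_right _ h)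
  have h1 := V₁op_congr_st T U η hAs hA's
  have h2 := V₂op_congr_loc T U η hAl hA'l
  have hth := agree_through_of_stBonds T hA's
  have hthA := agree_through_of_stBonds T hAs
  have h3 : deltaPrimeOp T U η A' μ x = deltaPrimeOp T U η B' μ x := deltaPrimeOp_congr_local T U η μ x hth
  have h4 : deltaPrimeOp T (prodCfg U η A) η A' μ x = deltaPrimeOp T (prodCfg U η B) η B' μ x := by
    rw [deltaPrimeOp_congr_local T (prodCfg U η A) η μ x hth]
    refine deltaPrimeOp_congr_cfg T η B' μ x fun κ ν y h => ?_
    obtain ⟨e₁, e₂, e₃, e₄⟩ := hthA κ ν y h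
    exact ⟨prodCfg_congr_pt U η e₁, prodCfg_congr_pt U η e₂, prodCfg_congr_pt U η e₃, prodCfg_congr_pt U η e₄⟩
  simp only [V₃val, h1, h2, h3, h4]

end V3

/-! ## §5  Sanity -/

section Examples

variable {𝔸 : Type*} [NormedRing 𝔸] [NormedAlgebra ℂ 𝔸] [CompleteSpace 𝔸] {S : Type*} {ι : Type*}
variable (T : ι → Equiv.Perm S) (U : ι → S → 𝔸ˣ) [Fintype ι] [LinearOrder ι]

/-- No fluctuation field, no difference: `Δ′(U′U) − Δ′(U) = 0` at `A = 0` (`B9Eq369Product.prodCfg_zero`) … -/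
example (η : ℝ) (A' : ι → S → 𝔸) (μ : ι) (x : S) :
    deltaPrimeOp T (prodCfg U η (0 : ι → S → 𝔸)) η A' μ x - deltaPrimeOp T U η A' μ x = 0 := by
  rw [prodCfg_zero, sub_self]

/-- … so `V₃(0)A′ = η⁻²(V₁op + V₂op)` at `A = 0` (both of which vanish there, `B9Eq371Composition`/`B9Eq375Composition` §5). -/
example (η : ℝ) (A' : ι → S → 𝔸) (μ : ι) (x : S) :
    V₃val T U η 0 A' μ x = (((η : ℂ)⁻¹) ^ 2) • V₁op T U η 0 A' μ x + (((η : ℂ)⁻¹) ^ 2) • V₂op T U η 0 A' μ x := by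
  simp only [V₃val, vThree, prodCfg_zero, sub_self, sub_zero]

/-- Equal configurations: the two-configuration bound of §2 with `σ = θ = 0` is `0`, consistently. -/
example (ρ δ a : ℝ) : (14 * ρ ^ 4 * 0 + 15 * ρ ^ 2 * 0 * δ) * a * ((Fintype.card ι - 1 : ℕ) : ℝ) = 0 := by ring

/-- The constants at `α₁ = C₀ = 0`: `k_P = 2`, `k_Δ = 28`. -/
example : kP 0 0 = 2 ∧ kΔ 0 0 = 28 := by
  refine ⟨by simp [kP], ?_⟩
  simp [kΔ, kP]
  norm_num

end Examples

end Literature.MathematicalPhysics.QuantumFieldTheory.Balaban1983to89.B9Eq373V3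

end
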